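import Literature.Probability.TransportMaps.DobrushinPecherskyContraction
import Literature.Probability.TransportMaps.DobrushinPecherskySweep
import HarnessLib

/-!
# The regional Dobrushin–Pechersky sweep (Lemma 3.8) and the decay recursion (dc3), (dc11)–(dc12)
# behind Theorem 2.7 (Conache–Kondratiev–Kozitsky–Pasurek 2015, §3.4, §4.3)

[topic Probability/TransportMaps]

[ConacheEtAl2015] D. Conache, Yu. Kondratiev, Yu. Kozitsky, T. Pasurek, arXiv:1501.00673, after
[DobrushinPechersky1983]. §3.4 (verbatim up to notation): «For such `D`, we define
`∂D = {ℓ' ∈ Dᶜ : ∂ℓ' ∩ D ≠ ∅}` … (dc2) `γ_D(ν) = sup_{ℓ∈D} ν(I_ℓ)`,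
`λ_D(ν) = max_i sup_{ℓ₁,ℓ₂∈D} ν(I_{ℓ₁} H^i_{ℓ₂})`. Next, for `N = δ(ℓ₁, ℓ₂)`, we set
`D₀ = {ℓ₁}`, `D_k = D_{k−1} ∪ ∂D_{k−1}`, `k = 1, …, N − 1`.»
**Lemma 3.8.** «… there exist `ν₁^x, …, ν_{N−1}^x ∈ 𝒞(μ^x, μ)` … such that
(dc3) `(γ_{D_{N−s−1}}(ν_s^x), λ_{D_{N−s−1}}(ν_s^x))ᵀ ≤ M(K) (γ_{D_{N−s}}(ν_{s−1}^x), λ_{D_{N−s}}(ν_{s−1}^x))ᵀ`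
for all `s = 1, …, N − 1`», proved in §4.3: «we split `D_{N−s−1}` into independent subsets by taking
intersections with the sets `V_j` … perform the reconstruction over the remaining independent subsets
of `D_{N−s−1}` … the parameters `γ_{D_{N−s−1}}(ν_s^x)` and `λ_{D_{N−s−1}}(ν_s^x)` satisfy the
first-line inequalities in (41) and (42)». Then (§3.4, (dc11)–(dc12)): with `T = diag(ξ, 1)`,
`‖ṽ_s‖ ≤ r_K ‖ṽ_{s−1}‖`, «which yields (dc12)
`γ_{D₀}(ν^x_{N−1}) ≤ r_K^{N−1} max{γ_{D_{N−1}}(ν₀^x); ξ⁻¹ λ_{D_{N−1}}(ν₀^x)}`».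

THIS FILE is the REGIONAL form of `DobrushinPecherskySweep` (same abstract data `DPSystem`,
`Admissible`; the one-step estimates are required only at the sites of a region `Λ`, `IsDPStepOn Λ`,
with `IsDPStep.isDPStepOn` and `IsDPStepOn.classBounds` — every result below comes in an `…On`
form and in the `IsDPStep` form): the table (41)–(42) with every site quantifier restricted to a domain `D'`
(`TableOn`), its propagation over one independent class whose sites AND out-neighbourhoods lie in `D'`
(`tableOn_base`, `tableOn_step` — the proofs of §4.1–4.2 verbatim, as print says in §4.3), the sweep
over the colour classes of a finite region `D` with `D ∪ ∂D ⊆ D'` (`sweepRegion`, ★ `lemma_3_8_step`: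
(27) and (28′) for `ℓ, ℓ' ∈ D` from bounds on `D'` — the content of (dc3), with the second row
`(Δ^χ, c̄Δ^{χ+1})` that §4 yields, see the Sweep file's reading note E-DP-1), and the decay recursion
along a nested chain of regions (`regionSeq`, ★ `regionSeq_decay` = (dc12): `γ_{E_n}(ν_n) ≤ rⁿ max{γ_{E₀}(ν₀), ξ⁻¹λ_{E₀}(ν₀)}`
for any chain `E₀ ⊇ E₁ ∪ ∂E₁ ⊇ E₁ ⊇ E₂ ∪ ∂E₂ ⊇ …` and any weight/rate satisfying the two row
conditions of `DobrushinPecherskyContraction.max_step_le` — printed: `E_s = D_{N−1−s}`, packaged as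
`descChain` ∕ `dc12_printed`; ★ `exists_regional_rate_lt_one`: below the threshold the Perron root
`r < 1` and a weight `ξ > 0` work uniformly in the chain and the initial state).

What is NOT here (instance level, left to the coupling files): the conditional measures `μ^x`, the
`F_{D_{N−1}}`-measurability of the `ν_s^x`, the covariance identity (dc6)–(dc9) and hence the final
(dc) `|Cov_μ(f;g)| ≤ C_K ‖f‖ ‖g‖ exp(−α_K δ(ℓ₁,ℓ₂))`. Nothing about lattice gauge theory or mass gaps.
No named facts.

## References
* [ConacheEtAl2015] arXiv:1501.00673, §3.4 (dc2)–(dc3), Lemma 3.8, (dc11)–(dc12); §4.3. Quoted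
  from the held TeX, pp. 10–11, 16.
* [DobrushinPechersky1983] LNM 1021 (1983) 97–110.
-/

noncomputable section

open Finset

open scoped ENNReal NNReal

namespace Literature.Probability.TransportMaps

namespace DobrushinPecherskySweep

namespace DPSystem

variable {ι : Type*} {St : Type*} {A : Type*} [Fintype A] {S : DPSystem ι St A}

/-! ### Elementary summation bounds in `ℝ≥0∞` (as in the Sweep file; private there) -/

section sums

variable {β : Type*} {s : Finset β}

/-- `Σ_{x∈s} f x ≤ Δ·B` when `f ≤ B` on `s` and `#s ≤ Δ`. [folklore] -/
private theorem sum_le_of_le_card' {f : β → ℝ≥0∞} {B : ℝ≥0∞} {Δ : ℕ} (hs : s.card ≤ Δ)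
    (hf : ∀ x ∈ s, f x ≤ B) : ∑ x ∈ s, f x ≤ (Δ : ℝ≥0∞) * B :=
  calc ∑ x ∈ s, f x ≤ ∑ _x ∈ s, B := sum_le_sum hf
    _ = (s.card : ℝ≥0∞) * B := by rw [sum_const, nsmul_eq_mul]
    _ ≤ (Δ : ℝ≥0∞) * B := by gcongr

/-- `Σ_{x∈s} w x · f x ≤ W·B` when `f ≤ B` on `s` and `Σ w ≤ W`. [folklore] -/
private theorem sum_mul_le_of_row' {w f : β → ℝ≥0∞} {W B : ℝ≥0∞} (hw : ∑ x ∈ s, w x ≤ W)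
    (hf : ∀ x ∈ s, f x ≤ B) : ∑ x ∈ s, w x * f x ≤ W * B :=
  calc ∑ x ∈ s, w x * f x ≤ ∑ x ∈ s, w x * B := sum_le_sum fun x hx => mul_le_mul' le_rfl (hf x hx)
    _ = (∑ x ∈ s, w x) * B := by rw [sum_mul]
    _ ≤ W * B := by gcongr

end sums

/-! ### The one-step estimates at the sites of a region only -/

variable (S) in
/-- **Lemma 3.4 (b) + Lemma 3.6, required only at the sites of a set `Λ`** — the hypotheses under
which regional sweeps INSIDE `Λ` obey the bounds of §4 (print's Lemma 3.8 reconstructs only sites of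
`D_{N−s−1} ⊆ D_{N−1}`; for Theorem 2.7 the state `μ^x ⊗ μ` is consistent with the specification only
inside `D_{N−1}`). `IsDPStep` is the case `Λ = univ` (`IsDPStep.isDPStepOn`).
[cite: ConacheEtAl2015, Lemma 3.4 (b), Lemma 3.6 (21)–(24), Lemma 3.8] -/
structure IsDPStepOn (Λ : Set ι) : Prop where
  γ_of_ne : ∀ ν, ∀ ℓ ∈ Λ, ∀ ℓ', ℓ' ≠ ℓ → S.γf (S.R ℓ ν) ℓ' ≤ S.γf ν ℓ'
  Λ_of_ne : ∀ ν a, ∀ ℓ ∈ Λ, ∀ ℓ₁ ℓ₂, ℓ₁ ≠ ℓ → ℓ₂ ≠ ℓ → S.Λ (S.R ℓ ν) a ℓ₁ ℓ₂ ≤ S.Λ ν a ℓ₁ ℓ₂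
  h21 : ∀ ν, ∀ ℓ ∈ Λ, S.γf (S.R ℓ ν) ℓ ≤ (∑ ℓ' ∈ S.nbr ℓ, S.κ ℓ ℓ' * S.γf ν ℓ') +
    (S.ε : ℝ≥0∞) * ∑ a, ∑ ℓ₁ ∈ S.nbr ℓ, ∑ ℓ₂ ∈ S.nbr ℓ, S.Λ ν a ℓ₂ ℓ₁
  h22 : ∀ ν a, ∀ ℓ ∈ Λ, ∀ ℓ₁, ℓ₁ ≠ ℓ →
    S.Λ (S.R ℓ ν) a ℓ₁ ℓ ≤ S.γf ν ℓ₁ + ∑ ℓ₂ ∈ S.nbr ℓ, S.c a ℓ ℓ₂ * S.Λ ν a ℓ₁ ℓ₂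
  h23 : ∀ ν a, ∀ ℓ ∈ Λ, ∀ ℓ₁, ℓ₁ ≠ ℓ → S.Λ (S.R ℓ ν) a ℓ ℓ₁ ≤ ∑ ℓ₂ ∈ S.nbr ℓ, S.Λ ν a ℓ₂ ℓ₁
  h24 : ∀ ν a, ∀ ℓ ∈ Λ, S.Λ (S.R ℓ ν) a ℓ ℓ ≤ (∑ ℓ₁ ∈ S.nbr ℓ, S.γf ν ℓ₁) +
    ∑ ℓ₁ ∈ S.nbr ℓ, ∑ ℓ₂ ∈ S.nbr ℓ, S.c a ℓ ℓ₂ * S.Λ ν a ℓ₁ ℓ₂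

/-- The global one-step estimates restrict to any region. [cite: ConacheEtAl2015, Lemma 3.6 (21)–(24)] -/
theorem IsDPStep.isDPStepOn (h : S.IsDPStep) (Λ : Set ι) : S.IsDPStepOn Λ :=
  ⟨fun ν ℓ _ ℓ' hne => h.γ_of_ne ν ℓ ℓ' hne, fun ν a ℓ _ ℓ₁ ℓ₂ h₁ h₂ => h.Λ_of_ne ν a ℓ ℓ₁ ℓ₂ h₁ h₂,
    fun ν ℓ _ => h.h21 ν ℓ, fun ν a ℓ _ ℓ₁ h₁ => h.h22 ν a ℓ ℓ₁ h₁,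
    fun ν a ℓ _ ℓ₁ h₁ => h.h23 ν a ℓ ℓ₁ h₁, fun ν a ℓ _ => h.h24 ν a ℓ⟩

/-- Monotonicity in the region. [cite: ConacheEtAl2015, Lemma 3.6 (21)–(24)] -/
theorem IsDPStepOn.mono {Λ Λ' : Set ι} (h : S.IsDPStepOn Λ) (hΛ : Λ' ⊆ Λ) : S.IsDPStepOn Λ' :=
  ⟨fun ν ℓ hℓ => h.γ_of_ne ν ℓ (hΛ hℓ), fun ν a ℓ hℓ => h.Λ_of_ne ν a ℓ (hΛ hℓ),
    fun ν ℓ hℓ => h.h21 ν ℓ (hΛ hℓ), fun ν a ℓ hℓ => h.h22 ν a ℓ (hΛ hℓ),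
    fun ν a ℓ hℓ => h.h23 ν a ℓ (hΛ hℓ), fun ν a ℓ hℓ => h.h24 ν a ℓ (hΛ hℓ)⟩

/-- Lemma 3.4 (b) at a site of the region. [cite: ConacheEtAl2015, Lemma 3.4 (b)] -/
theorem IsDPStepOn.domOn_R {Λ : Set ι} (h : S.IsDPStepOn Λ) {ℓ : ι} (hℓ : ℓ ∈ Λ) (ν : St) :
    S.DomOn {x | x ≠ ℓ} (S.R ℓ ν) ν :=
  ⟨fun x hx => h.γ_of_ne ν ℓ hℓ x hx, fun a x hx y hy => h.Λ_of_ne ν a ℓ hℓ x y hx hy⟩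

/-- **The class sweep inside a region** (the structural part of §4.1–4.2, as in
`IsDPStep.classBounds`, for an independent list of distinct sites OF `Λ`).
[cite: ConacheEtAl2015, §4.1–4.2, §4.3] -/
theorem IsDPStepOn.classBounds {Λ : Set ι} (h : S.IsDPStepOn Λ) :
    ∀ (L : List ι), L.Nodup → (∀ x ∈ L, ∀ y ∈ S.nbr x, y ∉ L) → (∀ x ∈ L, x ∈ Λ) →
      ∀ ν, S.ClassBounds L ν (S.sweepList L ν) := by
  intro L
  induction L with
  | nil =>
    intro _ _ _ ν
    exact ⟨fun _ _ => le_rfl, fun _ _ _ _ _ => le_rfl, fun _ h => by simp at h,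
      fun _ _ h => by simp at h, fun _ _ _ _ h => by simp at h, fun _ _ h => by simp at h,
      fun _ _ h => by simp at h⟩
  | cons ℓ L ih =>
    intro hnd hind hΛ ν
    rw [List.nodup_cons] at hnd
    obtain ⟨hℓL, hndL⟩ := hnd
    have hℓΛ : ℓ ∈ Λ := hΛ ℓ List.mem_cons_self
    have hLΛ : ∀ x ∈ L, x ∈ Λ := fun x hx => hΛ x (List.mem_cons_of_mem _ hx)
    -- independence facts
    have hindL : ∀ x ∈ L, ∀ y ∈ S.nbr x, y ∉ L := fun x hx y hy hyL =>
      hind x (List.mem_cons_of_mem _ hx) y hy (List.mem_cons_of_mem _ hyL)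
    have hne : ∀ x ∈ ℓ :: L, ∀ y ∈ S.nbr x, y ≠ ℓ := fun x hx y hy hyl =>
      hind x hx y hy (hyl ▸ List.mem_cons_self)
    have hneL : ∀ x ∈ L, ∀ y ∈ S.nbr x, y ≠ ℓ := fun x hx => hne x (List.mem_cons_of_mem _ hx)
    set ν₁ := S.R ℓ ν with hν₁
    have hd : S.DomOn {x | x ≠ ℓ} ν₁ ν := h.domOn_R hℓΛ ν
    have IH := ih hndL hindL hLΛ ν₁
    rw [sweepList_cons]
    refine ⟨?_, ?_, ?_, ?_, ?_, ?_, ?_⟩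
    · intro x hx
      rw [List.mem_cons, not_or] at hx
      exact (IH.γ_off x hx.2).trans (hd.1 x hx.1)
    · intro a x y hx hy
      rw [List.mem_cons, not_or] at hx hy
      exact (IH.Λ_off a x y hx.2 hy.2).trans (hd.2 a x hx.1 y hy.1)
    · intro x hx
      rcases List.mem_cons.1 hx with rfl | hx
      · exact (IH.γ_off x hℓL).trans (h.h21 ν x hℓΛ)
      · exact (IH.γ_on x hx).trans (b21_mono hd (hneL x hx))
    · intro a x hx y hy
      rw [List.mem_cons, not_or] at hy
      rcases List.mem_cons.1 hx with rfl | hx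
      · exact (IH.Λ_off a x y hℓL hy.2).trans (h.h23 ν a x hℓΛ y hy.1)
      · exact (IH.Λ_on_off a x hx y hy.2).trans (b23_mono hd hy.1 (hneL x hx))
    · intro a x hx y hy
      rw [List.mem_cons, not_or] at hx
      rcases List.mem_cons.1 hy with rfl | hy
      · exact (IH.Λ_off a x y hx.2 hℓL).trans (h.h22 ν a y hℓΛ x hx.1)
      · exact (IH.Λ_off_on a x hx.2 y hy).trans (b22_mono hd hx.1 (hneL y hy))
    · intro a x hx
      rcases List.mem_cons.1 hx with rfl | hx
      · exact (IH.Λ_off a x x hℓL hℓL).trans (h.h24 ν a x hℓΛ)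
      · exact (IH.Λ_diag a x hx).trans (b24_mono hd (hneL x hx))
    · intro a x hx y hy hxy
      rcases List.mem_cons.1 hx with hxℓ | hxL <;> rcases List.mem_cons.1 hy with hyℓ | hyL
      · exact absurd (hxℓ.trans hyℓ.symm) hxy
      · subst hxℓ
        refine le_trans ?_ (le_max_left _ _)
        calc S.Λ (S.sweepList L ν₁) a x y ≤ S.b22 ν₁ a x y := IH.Λ_off_on a x hℓL y hyL
          _ ≤ S.b21 ν x + ∑ ℓ₂ ∈ S.nbr y, S.c a y ℓ₂ * S.b23 ν a x ℓ₂ := by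
              unfold b22
              gcongr with z hz
              · exact h.h21 ν x hℓΛ
              · exact h.h23 ν a x hℓΛ z (hneL y hyL z hz)
      · subst hyℓ
        refine le_trans ?_ (le_max_right _ _)
        calc S.Λ (S.sweepList L ν₁) a x y ≤ S.b23 ν₁ a x y := IH.Λ_on_off a x hxL y hℓL
          _ ≤ ∑ ℓ₁ ∈ S.nbr x, S.b22 ν a ℓ₁ y := by
              unfold b23
              gcongr with z hz
              exact h.h22 ν a y hℓΛ z (hneL x hxL z hz)
      · exact (IH.Λ_on_on a x hxL y hyL hxy).trans
          (max_le_max (b50_mono hd (hneL x hxL) (hneL y hyL)) (b54_mono hd (hneL x hxL) (hneL y hyL)))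

/-! ### The regional table -/

variable (S) in
/-- **The table (41)–(42) at level `j`, restricted to a domain `D'`** (print §4.3: «`ν̃_m^x(I_ℓ)` and
`ν̃_m^x(I_ℓ H^i_{ℓ'})`, `ℓ, ℓ' ∈ D_{N−s−1}`, satisfy the inequalities in (39) and (40) … in which the
right-hand sides contain `γ_{D_{N−s}}` and `λ_{D_{N−s}}`»): processed set `U ⊆ D'`, the `W`-rows are the
sites of `D' ∖ U`, and `γ₀`, `Λ₀` bound the pre-sweep functionals on `D'` only.
[cite: ConacheEtAl2015, §4.2 (41)–(42), §4.3] -/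
structure TableOn (Δ : ℕ) (κbar cbar α : ℝ≥0) (γ₀ Λ₀ : ℝ≥0∞) (D' U : Set ι) (j : ℕ) (ν : St) :
    Prop where
  γ_U : ∀ ℓ ∈ U, S.γf ν ℓ ≤ ((κbar : ℝ≥0∞) + α) * γ₀ + 2 * (α : ℝ≥0∞) * Λ₀
  γ_W : ∀ ℓ ∈ D', ℓ ∉ U → S.γf ν ℓ ≤ γ₀
  Λ_UU : ∀ a ℓ ℓ', ℓ ∈ U → ℓ' ∈ U →
    S.Λ ν a ℓ ℓ' ≤ (Δ : ℝ≥0∞) ^ j * γ₀ + (cbar : ℝ≥0∞) * (Δ : ℝ≥0∞) ^ (j + 1) * Λ₀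
  Λ_UW : ∀ a ℓ ℓ', ℓ ∈ U → ℓ' ∈ D' → ℓ' ∉ U → S.Λ ν a ℓ ℓ' ≤ (Δ : ℝ≥0∞) ^ j * Λ₀
  Λ_WU : ∀ a ℓ ℓ', ℓ ∈ D' → ℓ ∉ U → ℓ' ∈ U →
    S.Λ ν a ℓ ℓ' ≤ (j : ℝ≥0∞) * γ₀ + (cbar : ℝ≥0∞) * Λ₀
  Λ_WW : ∀ a ℓ ℓ', ℓ ∈ D' → ℓ ∉ U → ℓ' ∈ D' → ℓ' ∉ U → S.Λ ν a ℓ ℓ' ≤ Λ₀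

omit [Fintype A] in
/-- Level `0` on a domain: `γ_{D'}(ν) ≤ γ₀`, `λ_{D'}(ν) ≤ Λ₀` (print (dc2)). [cite: ConacheEtAl2015, §3.4 (dc2)] -/
theorem tableOn_empty {Δ : ℕ} {κbar cbar α : ℝ≥0} {γ₀ Λ₀ : ℝ≥0∞} {D' : Set ι} {ν : St}
    (hγ : ∀ ℓ ∈ D', S.γf ν ℓ ≤ γ₀) (hΛ : ∀ a, ∀ ℓ ∈ D', ∀ ℓ' ∈ D', S.Λ ν a ℓ ℓ' ≤ Λ₀) :
    S.TableOn Δ κbar cbar α γ₀ Λ₀ D' ∅ 0 ν :=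
  ⟨fun _ h => h.elim, fun ℓ hℓ _ => hγ ℓ hℓ, fun _ _ _ h => h.elim, fun _ _ _ h => h.elim,
    fun _ _ _ _ _ h => h.elim, fun a ℓ ℓ' hℓ _ hℓ' _ => hΛ a ℓ hℓ ℓ' hℓ'⟩

namespace TableOn

variable {Δ χ : ℕ} {κbar cbar α : ℝ≥0} {γ₀ Λ₀ : ℝ≥0∞} {D' U : Set ι} {j : ℕ} {ν : St}
  (hT : S.TableOn Δ κbar cbar α γ₀ Λ₀ D' U j ν) (hA : S.Admissible Δ χ κbar cbar α)
include hT hA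

/-- On `D'`, every `ν(I_ℓ)` is `≤ (1 + α)γ₀ + 2αΛ₀`. [cite: ConacheEtAl2015, §4.2 (41), §4.3] -/
theorem γ_all {ℓ : ι} (hℓD : ℓ ∈ D') :
    S.γf ν ℓ ≤ (1 + (α : ℝ≥0∞)) * γ₀ + 2 * (α : ℝ≥0∞) * Λ₀ := by
  by_cases hℓ : ℓ ∈ U
  · refine (hT.γ_U ℓ hℓ).trans ?_
    gcongr
    exact_mod_cast hA.κbar_le_one
  · calc S.γf ν ℓ ≤ γ₀ := hT.γ_W ℓ hℓD hℓ
      _ = 1 * γ₀ + 0 := by ring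
      _ ≤ (1 + (α : ℝ≥0∞)) * γ₀ + 2 * (α : ℝ≥0∞) * Λ₀ := by gcongr <;> simp

/-- Column bound on `D'`, `ℓ' ∈ U`. [cite: ConacheEtAl2015, §4.2 (42), §4.3] -/
theorem Λ_colU (a : A) {ℓ : ι} (hℓD : ℓ ∈ D') {ℓ' : ι} (hℓ' : ℓ' ∈ U) :
    S.Λ ν a ℓ ℓ' ≤ (Δ : ℝ≥0∞) ^ j * γ₀ + (cbar : ℝ≥0∞) * (Δ : ℝ≥0∞) ^ (j + 1) * Λ₀ := by
  by_cases hℓ : ℓ ∈ U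
  · exact hT.Λ_UU a ℓ ℓ' hℓ hℓ'
  · refine (hT.Λ_WU a ℓ ℓ' hℓD hℓ hℓ').trans ?_
    have h1 : (j : ℝ≥0∞) ≤ (Δ : ℝ≥0∞) ^ j := Admissible.cast_le_pow hA.two_le
    have h2 : (cbar : ℝ≥0∞) ≤ (cbar : ℝ≥0∞) * (Δ : ℝ≥0∞) ^ (j + 1) :=
      le_mul_of_one_le_right' (Admissible.one_le_pow' hA.two_le)
    gcongr

/-- Column bound on `D'`, `ℓ' ∈ D' ∖ U`. [cite: ConacheEtAl2015, §4.2 (42), §4.3] -/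
theorem Λ_colW (a : A) {ℓ : ι} (hℓD : ℓ ∈ D') {ℓ' : ι} (hℓ'D : ℓ' ∈ D') (hℓ' : ℓ' ∉ U) :
    S.Λ ν a ℓ ℓ' ≤ (Δ : ℝ≥0∞) ^ j * Λ₀ := by
  by_cases hℓ : ℓ ∈ U
  · exact hT.Λ_UW a ℓ ℓ' hℓ hℓ'D hℓ'
  · exact (hT.Λ_WW a ℓ ℓ' hℓD hℓ hℓ'D hℓ').trans
      (le_mul_of_one_le_left' (Admissible.one_le_pow' hA.two_le))

/-- Row bound on `D'`, `ℓ ∈ D' ∖ U`. [cite: ConacheEtAl2015, §4.2 (42), §4.3] -/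
theorem Λ_rowW (a : A) {ℓ : ι} (hℓD : ℓ ∈ D') (hℓ : ℓ ∉ U) {ℓ' : ι} (hℓ'D : ℓ' ∈ D') :
    S.Λ ν a ℓ ℓ' ≤ (j : ℝ≥0∞) * γ₀ + Λ₀ := by
  by_cases hℓ' : ℓ' ∈ U
  · refine (hT.Λ_WU a ℓ ℓ' hℓD hℓ hℓ').trans ?_
    gcongr
    exact mul_le_of_le_one_left' hA.cbar_le_one
  · exact (hT.Λ_WW a ℓ ℓ' hℓD hℓ hℓ'D hℓ').trans le_add_self

/-- Global bound on `D'`. [cite: ConacheEtAl2015, §4.2 (42), §4.3] -/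
theorem Λ_all (hχ : 1 ≤ χ) (a : A) {ℓ : ι} (hℓD : ℓ ∈ D') {ℓ' : ι} (hℓ'D : ℓ' ∈ D') :
    S.Λ ν a ℓ ℓ' ≤ (Δ : ℝ≥0∞) ^ j * (γ₀ + Λ₀) := by
  have h3 : (cbar : ℝ≥0∞) * (Δ : ℝ≥0∞) ^ (j + 1) ≤ (Δ : ℝ≥0∞) ^ j := hA.cbar_pow_succ_le hχ
  rw [mul_add]
  by_cases hℓ' : ℓ' ∈ U
  · refine (hT.Λ_colU hA a hℓD hℓ').trans ?_
    gcongr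
  · calc S.Λ ν a ℓ ℓ' ≤ (Δ : ℝ≥0∞) ^ j * Λ₀ := hT.Λ_colW hA a hℓD hℓ'D hℓ'
      _ ≤ (Δ : ℝ≥0∞) ^ j * γ₀ + (Δ : ℝ≥0∞) ^ j * Λ₀ := le_add_self

end TableOn

/-! ### §4.1 restricted to a domain -/

namespace Admissible

variable {Δ χ : ℕ} {κbar cbar α : ℝ≥0} (hA : S.Admissible Δ χ κbar cbar α)
include hA

/-- **§4.1 on a domain** (print §4.3, first class of `D_{N−s−1}`): from `γ_{D'}(ν) ≤ γ₀`,
`λ_{D'}(ν) ≤ Λ₀` to the level-`1` table on `D'` for `U = L`, when the class `L` and all its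
out-neighbourhoods lie in `D'`. [cite: ConacheEtAl2015, §4.1 (31)–(40), §4.3] -/
theorem tableOn_base (hχ : 1 ≤ χ) {γ₀ Λ₀ : ℝ≥0∞} {D' : Set ι} {ν ν' : St}
    (hγ : ∀ ℓ ∈ D', S.γf ν ℓ ≤ γ₀) (hΛ : ∀ a, ∀ ℓ ∈ D', ∀ ℓ' ∈ D', S.Λ ν a ℓ ℓ' ≤ Λ₀)
    {L : List ι} (hnbrD : ∀ ℓ ∈ L, ∀ x ∈ S.nbr ℓ, x ∈ D') (hB : S.ClassBounds L ν ν') :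
    S.TableOn Δ κbar cbar α γ₀ Λ₀ D' {x | x ∈ L} 1 ν' := by
  have hcard := hA.card_nbr_le
  have hb21 : ∀ ℓ ∈ L, S.b21 ν ℓ ≤ (κbar : ℝ≥0∞) * γ₀ +
      (S.ε : ℝ≥0∞) * ((Fintype.card A : ℝ≥0∞) * ((Δ : ℝ≥0∞) * ((Δ : ℝ≥0∞) * Λ₀))) := by
    intro ℓ hℓ
    refine add_le_add (sum_mul_le_of_row' (hA.κ_row ℓ) fun x hx => hγ x (hnbrD ℓ hℓ x hx))
      (mul_le_mul' le_rfl ?_)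
    calc ∑ a, ∑ x ∈ S.nbr ℓ, ∑ y ∈ S.nbr ℓ, S.Λ ν a y x
        ≤ ∑ _a : A, (Δ : ℝ≥0∞) * ((Δ : ℝ≥0∞) * Λ₀) :=
          sum_le_sum fun a _ => sum_le_of_le_card' (hcard ℓ) fun x hx =>
            sum_le_of_le_card' (hcard ℓ) fun y hy => hΛ a y (hnbrD ℓ hℓ y hy) x (hnbrD ℓ hℓ x hx)
      _ = (Fintype.card A : ℝ≥0∞) * ((Δ : ℝ≥0∞) * ((Δ : ℝ≥0∞) * Λ₀)) := by
          rw [sum_const, nsmul_eq_mul, card_univ]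
  have hb23 : ∀ a, ∀ ℓ ∈ L, ∀ y ∈ D', S.b23 ν a ℓ y ≤ (Δ : ℝ≥0∞) * Λ₀ := fun a ℓ hℓ y hy =>
    sum_le_of_le_card' (hcard ℓ) fun x hx => hΛ a x (hnbrD ℓ hℓ x hx) y hy
  have hb22 : ∀ a, ∀ x ∈ D', ∀ ℓ' ∈ L, S.b22 ν a x ℓ' ≤ γ₀ + (cbar : ℝ≥0∞) * Λ₀ :=
    fun a x hx ℓ' hℓ' => add_le_add (hγ x hx)
      (sum_mul_le_of_row' (hA.c_row a ℓ') fun y hy => hΛ a x hx y (hnbrD ℓ' hℓ' y hy))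
  have hb24 : ∀ a, ∀ ℓ ∈ L,
      S.b24 ν a ℓ ≤ (Δ : ℝ≥0∞) * γ₀ + (Δ : ℝ≥0∞) * ((cbar : ℝ≥0∞) * Λ₀) :=
    fun a ℓ hℓ => add_le_add (sum_le_of_le_card' (hcard ℓ) fun x hx => hγ x (hnbrD ℓ hℓ x hx))
      (sum_le_of_le_card' (hcard ℓ) fun x hx => sum_mul_le_of_row' (hA.c_row a ℓ) fun y hy =>
        hΛ a x (hnbrD ℓ hℓ x hx) y (hnbrD ℓ hℓ y hy))
  have hb50 : ∀ a, ∀ ℓ ∈ L, ∀ ℓ' ∈ L, S.b50 ν a ℓ ℓ' ≤ (κbar : ℝ≥0∞) * γ₀ +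
      (S.ε : ℝ≥0∞) * ((Fintype.card A : ℝ≥0∞) * ((Δ : ℝ≥0∞) * ((Δ : ℝ≥0∞) * Λ₀))) +
      (cbar : ℝ≥0∞) * ((Δ : ℝ≥0∞) * Λ₀) := fun a ℓ hℓ ℓ' hℓ' =>
    add_le_add (hb21 ℓ hℓ)
      (sum_mul_le_of_row' (hA.c_row a ℓ') fun y hy => hb23 a ℓ hℓ y (hnbrD ℓ' hℓ' y hy))
  have hb54 : ∀ a, ∀ ℓ ∈ L, ∀ ℓ' ∈ L,
      S.b54 ν a ℓ ℓ' ≤ (Δ : ℝ≥0∞) * (γ₀ + (cbar : ℝ≥0∞) * Λ₀) :=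
    fun a ℓ hℓ ℓ' hℓ' => sum_le_of_le_card' (hcard ℓ) fun x hx => hb22 a x (hnbrD ℓ hℓ x hx) ℓ' hℓ'
  have s1 := hA.eps_card_sq_le hχ
  have s2 := hA.κbar_le_Δ
  have s3 := hA.Δ_mul_cbar_le
  have s4 := hA.eps_card_sq_add_le hχ
  have hUU : ∀ a, ∀ ℓ ∈ L, ∀ ℓ' ∈ L, S.Λ ν' a ℓ ℓ' ≤
      (Δ : ℝ≥0∞) * γ₀ + (cbar : ℝ≥0∞) * ((Δ : ℝ≥0∞) * (Δ : ℝ≥0∞)) * Λ₀ := by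
    intro a ℓ hℓ ℓ' hℓ'
    by_cases hne : ℓ = ℓ'
    · subst hne
      calc S.Λ ν' a ℓ ℓ ≤ S.b24 ν a ℓ := hB.Λ_diag a ℓ hℓ
        _ ≤ (Δ : ℝ≥0∞) * γ₀ + (Δ : ℝ≥0∞) * ((cbar : ℝ≥0∞) * Λ₀) := hb24 a ℓ hℓ
        _ = (Δ : ℝ≥0∞) * γ₀ + ((Δ : ℝ≥0∞) * (cbar : ℝ≥0∞)) * Λ₀ := by ring
        _ ≤ (Δ : ℝ≥0∞) * γ₀ + (cbar : ℝ≥0∞) * ((Δ : ℝ≥0∞) * (Δ : ℝ≥0∞)) * Λ₀ := by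
            gcongr
    · refine (hB.Λ_on_on a ℓ hℓ ℓ' hℓ' hne).trans (max_le ?_ ?_)
      · calc S.b50 ν a ℓ ℓ' ≤ _ := hb50 a ℓ hℓ ℓ' hℓ'
          _ = (κbar : ℝ≥0∞) * γ₀ + ((S.ε : ℝ≥0∞) * ((Fintype.card A : ℝ≥0∞) *
                ((Δ : ℝ≥0∞) * (Δ : ℝ≥0∞))) + (cbar : ℝ≥0∞) * Δ) * Λ₀ := by ring
          _ ≤ (Δ : ℝ≥0∞) * γ₀ + (cbar : ℝ≥0∞) * ((Δ : ℝ≥0∞) * (Δ : ℝ≥0∞)) * Λ₀ := by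
              gcongr
      · calc S.b54 ν a ℓ ℓ' ≤ _ := hb54 a ℓ hℓ ℓ' hℓ'
          _ = (Δ : ℝ≥0∞) * γ₀ + ((Δ : ℝ≥0∞) * (cbar : ℝ≥0∞)) * Λ₀ := by ring
          _ ≤ (Δ : ℝ≥0∞) * γ₀ + (cbar : ℝ≥0∞) * ((Δ : ℝ≥0∞) * (Δ : ℝ≥0∞)) * Λ₀ := by
              gcongr
  refine ⟨?_, ?_, ?_, ?_, ?_, ?_⟩
  · intro ℓ hℓ
    calc S.γf ν' ℓ ≤ S.b21 ν ℓ := hB.γ_on ℓ hℓ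
      _ ≤ _ := hb21 ℓ hℓ
      _ = (κbar : ℝ≥0∞) * γ₀ + ((S.ε : ℝ≥0∞) * ((Fintype.card A : ℝ≥0∞) *
            ((Δ : ℝ≥0∞) * (Δ : ℝ≥0∞)))) * Λ₀ := by ring
      _ ≤ ((κbar : ℝ≥0∞) + α) * γ₀ + 2 * (α : ℝ≥0∞) * Λ₀ := by
          have hα2 : (α : ℝ≥0∞) ≤ 2 * (α : ℝ≥0∞) := by rw [two_mul]; exact le_self_add
          exact add_le_add (mul_le_mul' le_self_add le_rfl) (mul_le_mul' (s1.trans hα2) le_rfl)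
  · intro ℓ hℓD hℓ
    exact (hB.γ_off ℓ hℓ).trans (hγ ℓ hℓD)
  · intro a ℓ ℓ' hℓ hℓ'
    calc S.Λ ν' a ℓ ℓ' ≤ _ := hUU a ℓ hℓ ℓ' hℓ'
      _ = (Δ : ℝ≥0∞) ^ 1 * γ₀ + (cbar : ℝ≥0∞) * (Δ : ℝ≥0∞) ^ (1 + 1) * Λ₀ := by ring
  · intro a ℓ ℓ' hℓ hℓ'D hℓ'
    calc S.Λ ν' a ℓ ℓ' ≤ S.b23 ν a ℓ ℓ' := hB.Λ_on_off a ℓ hℓ ℓ' hℓ'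
      _ ≤ (Δ : ℝ≥0∞) * Λ₀ := hb23 a ℓ hℓ ℓ' hℓ'D
      _ = (Δ : ℝ≥0∞) ^ 1 * Λ₀ := by rw [pow_one]
  · intro a ℓ ℓ' hℓD hℓ hℓ'
    calc S.Λ ν' a ℓ ℓ' ≤ S.b22 ν a ℓ ℓ' := hB.Λ_off_on a ℓ hℓ ℓ' hℓ'
      _ ≤ γ₀ + (cbar : ℝ≥0∞) * Λ₀ := hb22 a ℓ hℓD ℓ' hℓ'
      _ = ((1 : ℕ) : ℝ≥0∞) * γ₀ + (cbar : ℝ≥0∞) * Λ₀ := by simp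
  · intro a ℓ ℓ' hℓD hℓ hℓ'D hℓ'
    exact (hB.Λ_off a ℓ ℓ' hℓ hℓ').trans (hΛ a ℓ hℓD ℓ' hℓ'D)

/-- **§4.2 on a domain** (print §4.3, «then we perform the reconstruction over the remaining
independent subsets of `D_{N−s−1}`»): the table on `D'` at level `j ≥ 1` for `U ⊆ D'` becomes, after
the class `L ⊆ D'` (out-neighbourhoods in `D'`), the table on `D'` at level `j + 1` for `U ∪ L`.
[cite: ConacheEtAl2015, §4.2 (41)–(54), §4.3] -/
theorem tableOn_step {j : ℕ} (hj1 : 1 ≤ j) (hjχ : j + 1 ≤ χ) {γ₀ Λ₀ : ℝ≥0∞} {D' U : Set ι}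
    (hUD : U ⊆ D') {ν ν' : St} (hT : S.TableOn Δ κbar cbar α γ₀ Λ₀ D' U j ν) {L : List ι}
    (hnbrD : ∀ ℓ ∈ L, ∀ x ∈ S.nbr ℓ, x ∈ D') (hB : S.ClassBounds L ν ν') :
    S.TableOn Δ κbar cbar α γ₀ Λ₀ D' (U ∪ {x | x ∈ L}) (j + 1) ν' := by
  have hχ : 1 ≤ χ := by omega
  have hcard := hA.card_nbr_le
  have h1D := hA.one_le_Δ
  have hΓ := fun x (hx : x ∈ D') => hT.γ_all hA hx
  have hΘ := fun a x (hx : x ∈ D') y (hy : y ∈ D') => hT.Λ_all hA hχ a hx hy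
  have hCU := fun a x (hx : x ∈ D') y (hy : y ∈ U) => hT.Λ_colU hA a hx hy
  have hCW := fun a x (hx : x ∈ D') y (hyD : y ∈ D') (hy : y ∉ U) => hT.Λ_colW hA a hx hyD hy
  have hRW := fun a x (hxD : x ∈ D') (hx : x ∉ U) y (hy : y ∈ D') => hT.Λ_rowW hA a hxD hx hy
  set Γ : ℝ≥0∞ := (1 + (α : ℝ≥0∞)) * γ₀ + 2 * (α : ℝ≥0∞) * Λ₀ with hΓdef
  set Θ : ℝ≥0∞ := (Δ : ℝ≥0∞) ^ j * (γ₀ + Λ₀) with hΘdef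
  have hb21 : ∀ ℓ ∈ L, S.b21 ν ℓ ≤ (κbar : ℝ≥0∞) * Γ +
      (S.ε : ℝ≥0∞) * ((Fintype.card A : ℝ≥0∞) * ((Δ : ℝ≥0∞) * ((Δ : ℝ≥0∞) * Θ))) := by
    intro ℓ hℓ
    refine add_le_add (sum_mul_le_of_row' (hA.κ_row ℓ) fun x hx => hΓ x (hnbrD ℓ hℓ x hx))
      (mul_le_mul' le_rfl ?_)
    calc ∑ a, ∑ x ∈ S.nbr ℓ, ∑ y ∈ S.nbr ℓ, S.Λ ν a y x
        ≤ ∑ _a : A, (Δ : ℝ≥0∞) * ((Δ : ℝ≥0∞) * Θ) :=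
          sum_le_sum fun a _ => sum_le_of_le_card' (hcard ℓ) fun x hx =>
            sum_le_of_le_card' (hcard ℓ) fun y hy =>
              hΘ a y (hnbrD ℓ hℓ y hy) x (hnbrD ℓ hℓ x hx)
      _ = (Fintype.card A : ℝ≥0∞) * ((Δ : ℝ≥0∞) * ((Δ : ℝ≥0∞) * Θ)) := by
          rw [sum_const, nsmul_eq_mul, card_univ]
  have hb23U : ∀ a, ∀ ℓ ∈ L, ∀ y ∈ U, S.b23 ν a ℓ y ≤ (Δ : ℝ≥0∞) *
      ((Δ : ℝ≥0∞) ^ j * γ₀ + (cbar : ℝ≥0∞) * (Δ : ℝ≥0∞) ^ (j + 1) * Λ₀) :=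
    fun a ℓ hℓ y hy => sum_le_of_le_card' (hcard ℓ) fun x hx => hCU a x (hnbrD ℓ hℓ x hx) y hy
  have hb23W : ∀ a, ∀ ℓ ∈ L, ∀ y ∈ D', y ∉ U →
      S.b23 ν a ℓ y ≤ (Δ : ℝ≥0∞) * ((Δ : ℝ≥0∞) ^ j * Λ₀) :=
    fun a ℓ hℓ y hyD hy => sum_le_of_le_card' (hcard ℓ) fun x hx =>
      hCW a x (hnbrD ℓ hℓ x hx) y hyD hy
  have hb23 : ∀ a, ∀ ℓ ∈ L, ∀ y ∈ D', S.b23 ν a ℓ y ≤ (Δ : ℝ≥0∞) * Θ :=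
    fun a ℓ hℓ y hy => sum_le_of_le_card' (hcard ℓ) fun x hx => hΘ a x (hnbrD ℓ hℓ x hx) y hy
  have hb22 : ∀ a, ∀ x ∈ D', ∀ ℓ' ∈ L, S.b22 ν a x ℓ' ≤ Γ + (cbar : ℝ≥0∞) * Θ :=
    fun a x hx ℓ' hℓ' => add_le_add (hΓ x hx)
      (sum_mul_le_of_row' (hA.c_row a ℓ') fun y hy => hΘ a x hx y (hnbrD ℓ' hℓ' y hy))
  have hb22W : ∀ a, ∀ x ∈ D', x ∉ U → ∀ ℓ' ∈ L,
      S.b22 ν a x ℓ' ≤ γ₀ + (cbar : ℝ≥0∞) * ((j : ℝ≥0∞) * γ₀ + Λ₀) :=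
    fun a x hxD hx ℓ' hℓ' => add_le_add (hT.γ_W x hxD hx)
      (sum_mul_le_of_row' (hA.c_row a ℓ') fun y hy => hRW a x hxD hx y (hnbrD ℓ' hℓ' y hy))
  have hb24 : ∀ a, ∀ ℓ ∈ L,
      S.b24 ν a ℓ ≤ (Δ : ℝ≥0∞) * Γ + (Δ : ℝ≥0∞) * ((cbar : ℝ≥0∞) * Θ) :=
    fun a ℓ hℓ => add_le_add (sum_le_of_le_card' (hcard ℓ) fun x hx => hΓ x (hnbrD ℓ hℓ x hx))
      (sum_le_of_le_card' (hcard ℓ) fun x hx => sum_mul_le_of_row' (hA.c_row a ℓ) fun y hy =>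
        hΘ a x (hnbrD ℓ hℓ x hx) y (hnbrD ℓ hℓ y hy))
  have hb50 : ∀ a, ∀ ℓ ∈ L, ∀ ℓ' ∈ L, S.b50 ν a ℓ ℓ' ≤ (κbar : ℝ≥0∞) * Γ +
      (S.ε : ℝ≥0∞) * ((Fintype.card A : ℝ≥0∞) * ((Δ : ℝ≥0∞) * ((Δ : ℝ≥0∞) * Θ))) +
      (cbar : ℝ≥0∞) * ((Δ : ℝ≥0∞) * Θ) := fun a ℓ hℓ ℓ' hℓ' =>
    add_le_add (hb21 ℓ hℓ)
      (sum_mul_le_of_row' (hA.c_row a ℓ') fun y hy => hb23 a ℓ hℓ y (hnbrD ℓ' hℓ' y hy))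
  have hb54 : ∀ a, ∀ ℓ ∈ L, ∀ ℓ' ∈ L,
      S.b54 ν a ℓ ℓ' ≤ (Δ : ℝ≥0∞) * (Γ + (cbar : ℝ≥0∞) * Θ) :=
    fun a ℓ hℓ ℓ' hℓ' => sum_le_of_le_card' (hcard ℓ) fun x hx =>
      hb22 a x (hnbrD ℓ hℓ x hx) ℓ' hℓ'
  have c45γ := hA.coeff45_γ (j := j) hjχ
  have c45Λ := hA.coeff45_Λ (j := j) hjχ
  have cUUγ := hA.coeffUU_γ (j := j) hj1 hjχ
  have cUUΛ := hA.coeffUU_Λ (j := j)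
  have cWU := hA.coeffWU_γ (j := j)
  have h45 : (κbar : ℝ≥0∞) * Γ +
      (S.ε : ℝ≥0∞) * ((Fintype.card A : ℝ≥0∞) * ((Δ : ℝ≥0∞) * ((Δ : ℝ≥0∞) * Θ))) ≤
      ((κbar : ℝ≥0∞) + α) * γ₀ + 2 * (α : ℝ≥0∞) * Λ₀ := by
    rw [hΓdef, hΘdef]
    calc (κbar : ℝ≥0∞) * ((1 + (α : ℝ≥0∞)) * γ₀ + 2 * (α : ℝ≥0∞) * Λ₀) +
          (S.ε : ℝ≥0∞) * ((Fintype.card A : ℝ≥0∞) *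
            ((Δ : ℝ≥0∞) * ((Δ : ℝ≥0∞) * ((Δ : ℝ≥0∞) ^ j * (γ₀ + Λ₀)))))
        = ((κbar : ℝ≥0∞) * (1 + α) + (S.ε : ℝ≥0∞) * ((Fintype.card A : ℝ≥0∞) *
            ((Δ : ℝ≥0∞) * ((Δ : ℝ≥0∞) * (Δ : ℝ≥0∞) ^ j)))) * γ₀ +
          ((κbar : ℝ≥0∞) * (2 * α) + (S.ε : ℝ≥0∞) * ((Fintype.card A : ℝ≥0∞) *
            ((Δ : ℝ≥0∞) * ((Δ : ℝ≥0∞) * (Δ : ℝ≥0∞) ^ j)))) * Λ₀ := by ring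
      _ ≤ ((κbar : ℝ≥0∞) + α) * γ₀ + 2 * (α : ℝ≥0∞) * Λ₀ :=
          add_le_add (mul_le_mul' c45γ le_rfl) (mul_le_mul' c45Λ le_rfl)
  have hUUm : (Δ : ℝ≥0∞) * Γ + (Δ : ℝ≥0∞) * ((cbar : ℝ≥0∞) * Θ) ≤
      (Δ : ℝ≥0∞) ^ (j + 1) * γ₀ + (cbar : ℝ≥0∞) * (Δ : ℝ≥0∞) ^ (j + 1 + 1) * Λ₀ := by
    rw [hΓdef, hΘdef]
    calc (Δ : ℝ≥0∞) * ((1 + (α : ℝ≥0∞)) * γ₀ + 2 * (α : ℝ≥0∞) * Λ₀) +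
          (Δ : ℝ≥0∞) * ((cbar : ℝ≥0∞) * ((Δ : ℝ≥0∞) ^ j * (γ₀ + Λ₀)))
        = (Δ : ℝ≥0∞) * (1 + α + (cbar : ℝ≥0∞) * (Δ : ℝ≥0∞) ^ j) * γ₀ +
          (Δ : ℝ≥0∞) * (2 * α + (cbar : ℝ≥0∞) * (Δ : ℝ≥0∞) ^ j) * Λ₀ := by ring
      _ ≤ (Δ : ℝ≥0∞) * (Δ : ℝ≥0∞) ^ j * γ₀ +
          (cbar : ℝ≥0∞) * ((Δ : ℝ≥0∞) * ((Δ : ℝ≥0∞) * (Δ : ℝ≥0∞) ^ j)) * Λ₀ :=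
          add_le_add (mul_le_mul' cUUγ le_rfl) (mul_le_mul' cUUΛ le_rfl)
      _ = (Δ : ℝ≥0∞) ^ (j + 1) * γ₀ + (cbar : ℝ≥0∞) * (Δ : ℝ≥0∞) ^ (j + 1 + 1) * Λ₀ := by
          ring
  have hΓC : Γ + (cbar : ℝ≥0∞) * Θ ≤ (Δ : ℝ≥0∞) * Γ + (Δ : ℝ≥0∞) * ((cbar : ℝ≥0∞) * Θ) :=
    add_le_add (le_mul_of_one_le_left' h1D) (le_mul_of_one_le_left' h1D)
  have h50 : (κbar : ℝ≥0∞) * Γ +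
      (S.ε : ℝ≥0∞) * ((Fintype.card A : ℝ≥0∞) * ((Δ : ℝ≥0∞) * ((Δ : ℝ≥0∞) * Θ))) +
      (cbar : ℝ≥0∞) * ((Δ : ℝ≥0∞) * Θ) ≤
      (Δ : ℝ≥0∞) * Γ + (Δ : ℝ≥0∞) * ((cbar : ℝ≥0∞) * Θ) := by
    refine add_le_add (h45.trans ?_) (le_of_eq (by ring))
    calc ((κbar : ℝ≥0∞) + α) * γ₀ + 2 * (α : ℝ≥0∞) * Λ₀ ≤ Γ := by
          rw [hΓdef]; gcongr; exact_mod_cast hA.κbar_le_one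
      _ ≤ (Δ : ℝ≥0∞) * Γ := le_mul_of_one_le_left' h1D
  have hjD : (Δ : ℝ≥0∞) ^ j ≤ (Δ : ℝ≥0∞) ^ (j + 1) := pow_le_pow_right₀ h1D (by omega)
  have hjD' : (Δ : ℝ≥0∞) ^ (j + 1) ≤ (Δ : ℝ≥0∞) ^ (j + 1 + 1) :=
    pow_le_pow_right₀ h1D (by omega)
  have hjj : (j : ℝ≥0∞) ≤ ((j + 1 : ℕ) : ℝ≥0∞) := by exact_mod_cast Nat.le_succ j
  refine ⟨?_, ?_, ?_, ?_, ?_, ?_⟩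
  · intro ℓ hℓ
    by_cases hL : ℓ ∈ L
    · exact (hB.γ_on ℓ hL).trans ((hb21 ℓ hL).trans h45)
    · have hU : ℓ ∈ U := by
        rcases hℓ with h | h
        · exact h
        · exact absurd h hL
      exact (hB.γ_off ℓ hL).trans (hT.γ_U ℓ hU)
  · intro ℓ hℓD hℓ
    simp only [Set.mem_union, Set.mem_setOf_eq, not_or] at hℓ
    exact (hB.γ_off ℓ hℓ.2).trans (hT.γ_W ℓ hℓD hℓ.1)
  · intro a ℓ ℓ' hℓ hℓ'
    by_cases hL : ℓ ∈ L
    · by_cases hL' : ℓ' ∈ L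
      · by_cases hne : ℓ = ℓ'
        · subst hne
          exact (hB.Λ_diag a ℓ hL).trans ((hb24 a ℓ hL).trans hUUm)
        · refine (hB.Λ_on_on a ℓ hL ℓ' hL' hne).trans (max_le ?_ ?_)
          · exact (hb50 a ℓ hL ℓ' hL').trans (h50.trans hUUm)
          · exact (hb54 a ℓ hL ℓ' hL').trans ((le_of_eq (by ring)).trans hUUm)
      · have hU' : ℓ' ∈ U := by
          rcases hℓ' with h | h
          · exact h
          · exact absurd h hL'
        calc S.Λ ν' a ℓ ℓ' ≤ S.b23 ν a ℓ ℓ' := hB.Λ_on_off a ℓ hL ℓ' hL'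
          _ ≤ _ := hb23U a ℓ hL ℓ' hU'
          _ = (Δ : ℝ≥0∞) ^ (j + 1) * γ₀ + (cbar : ℝ≥0∞) * (Δ : ℝ≥0∞) ^ (j + 1 + 1) * Λ₀ := by
              ring
    · have hU : ℓ ∈ U := by
        rcases hℓ with h | h
        · exact h
        · exact absurd h hL
      by_cases hL' : ℓ' ∈ L
      · calc S.Λ ν' a ℓ ℓ' ≤ S.b22 ν a ℓ ℓ' := hB.Λ_off_on a ℓ hL ℓ' hL'
          _ ≤ Γ + (cbar : ℝ≥0∞) * Θ := hb22 a ℓ (hUD hU) ℓ' hL'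
          _ ≤ _ := hΓC
          _ ≤ _ := hUUm
      · have hU' : ℓ' ∈ U := by
          rcases hℓ' with h | h
          · exact h
          · exact absurd h hL'
        calc S.Λ ν' a ℓ ℓ' ≤ S.Λ ν a ℓ ℓ' := hB.Λ_off a ℓ ℓ' hL hL'
          _ ≤ (Δ : ℝ≥0∞) ^ j * γ₀ + (cbar : ℝ≥0∞) * (Δ : ℝ≥0∞) ^ (j + 1) * Λ₀ :=
              hT.Λ_UU a ℓ ℓ' hU hU'
          _ ≤ (Δ : ℝ≥0∞) ^ (j + 1) * γ₀ + (cbar : ℝ≥0∞) * (Δ : ℝ≥0∞) ^ (j + 1 + 1) * Λ₀ := by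
              gcongr
  · intro a ℓ ℓ' hℓ hℓ'D hℓ'
    simp only [Set.mem_union, Set.mem_setOf_eq, not_or] at hℓ'
    by_cases hL : ℓ ∈ L
    · calc S.Λ ν' a ℓ ℓ' ≤ S.b23 ν a ℓ ℓ' := hB.Λ_on_off a ℓ hL ℓ' hℓ'.2
        _ ≤ (Δ : ℝ≥0∞) * ((Δ : ℝ≥0∞) ^ j * Λ₀) := hb23W a ℓ hL ℓ' hℓ'D hℓ'.1
        _ = (Δ : ℝ≥0∞) ^ (j + 1) * Λ₀ := by ring
    · have hU : ℓ ∈ U := by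
        rcases hℓ with h | h
        · exact h
        · exact absurd h hL
      calc S.Λ ν' a ℓ ℓ' ≤ S.Λ ν a ℓ ℓ' := hB.Λ_off a ℓ ℓ' hL hℓ'.2
        _ ≤ (Δ : ℝ≥0∞) ^ j * Λ₀ := hT.Λ_UW a ℓ ℓ' hU hℓ'D hℓ'.1
        _ ≤ (Δ : ℝ≥0∞) ^ (j + 1) * Λ₀ := by gcongr
  · intro a ℓ ℓ' hℓD hℓ hℓ'
    simp only [Set.mem_union, Set.mem_setOf_eq, not_or] at hℓ
    by_cases hL' : ℓ' ∈ L
    · calc S.Λ ν' a ℓ ℓ' ≤ S.b22 ν a ℓ ℓ' := hB.Λ_off_on a ℓ hℓ.2 ℓ' hL'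
        _ ≤ γ₀ + (cbar : ℝ≥0∞) * ((j : ℝ≥0∞) * γ₀ + Λ₀) := hb22W a ℓ hℓD hℓ.1 ℓ' hL'
        _ = (1 + (cbar : ℝ≥0∞) * (j : ℝ≥0∞)) * γ₀ + (cbar : ℝ≥0∞) * Λ₀ := by ring
        _ ≤ ((j + 1 : ℕ) : ℝ≥0∞) * γ₀ + (cbar : ℝ≥0∞) * Λ₀ := by gcongr
    · have hU' : ℓ' ∈ U := by
        rcases hℓ' with h | h
        · exact h
        · exact absurd h hL'
      calc S.Λ ν' a ℓ ℓ' ≤ S.Λ ν a ℓ ℓ' := hB.Λ_off a ℓ ℓ' hℓ.2 hL'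
        _ ≤ (j : ℝ≥0∞) * γ₀ + (cbar : ℝ≥0∞) * Λ₀ := hT.Λ_WU a ℓ ℓ' hℓD hℓ.1 hU'
        _ ≤ ((j + 1 : ℕ) : ℝ≥0∞) * γ₀ + (cbar : ℝ≥0∞) * Λ₀ := by gcongr
  · intro a ℓ ℓ' hℓD hℓ hℓ'D hℓ'
    simp only [Set.mem_union, Set.mem_setOf_eq, not_or] at hℓ hℓ'
    exact (hB.Λ_off a ℓ ℓ' hℓ.2 hℓ'.2).trans (hT.Λ_WW a ℓ ℓ' hℓD hℓ.1 hℓ'D hℓ'.1)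

end Admissible

/-! ### The sweep over the colour classes of a finite region (§4.3) -/

section region

variable {χ : ℕ}

/-- The part of the `j`-th colour class inside a finite region `D` (print §4.3: «we split
`D_{N−s−1}` into independent subsets by taking intersections with the sets `V_j`»).
[cite: ConacheEtAl2015, §4.3] -/
def classListIn (D : Finset ι) (col : ι → Fin χ) (j : Fin χ) : List ι :=
  (D.filter fun ℓ => col ℓ = j).toList

omit [Fintype A] in
/-- Membership in a regional class. [cite: ConacheEtAl2015, §4.3] -/
theorem mem_classListIn {D : Finset ι} {col : ι → Fin χ} {j : Fin χ} {ℓ : ι} :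
    ℓ ∈ classListIn D col j ↔ ℓ ∈ D ∧ col ℓ = j := by
  simp [classListIn]

omit [Fintype A] in
/-- Regional classes are enumerated without repetition. [cite: ConacheEtAl2015, §4.3] -/
theorem nodup_classListIn (D : Finset ι) (col : ι → Fin χ) (j : Fin χ) :
    (classListIn D col j).Nodup :=
  Finset.nodup_toList _

omit [Fintype A] in
/-- Regional classes of a proper colouring are independent. [cite: ConacheEtAl2015, §2.1 (2), §4.3] -/
theorem classListIn_independent {D : Finset ι} {col : ι → Fin χ}
    (hcol : ∀ ℓ, ∀ ℓ' ∈ S.nbr ℓ, col ℓ' ≠ col ℓ) (j : Fin χ) :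
    ∀ x ∈ classListIn D col j, ∀ y ∈ S.nbr x, y ∉ classListIn D col j := by
  intro x hx y hy hy'
  rw [mem_classListIn] at hx hy'
  exact hcol x y hy (hy'.2.trans hx.2.symm)

variable (S) in
/-- Reconstruction over the classes `V₀ ∩ D, …, V_{n−1} ∩ D` of a region `D`.
[cite: ConacheEtAl2015, §4.3] -/
def sweepRegionUpTo (D : Finset ι) (col : ι → Fin χ) (ν : St) : ℕ → St
  | 0 => ν
  | n + 1 => if h : n < χ then S.sweepList (classListIn D col ⟨n, h⟩) (sweepRegionUpTo D col ν n)
      else sweepRegionUpTo D col ν n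

variable (S) in
/-- **The regional sweep** (print: the passage `ν_{s−1}^x ↦ ν_s^x` of Lemma 3.8 — reconstruction over
all of `D = D_{N−s−1}`, class by class). [cite: ConacheEtAl2015, Lemma 3.8, §4.3] -/
def sweepRegion (D : Finset ι) (col : ι → Fin χ) (ν : St) : St := S.sweepRegionUpTo D col ν χ

omit [Fintype A] in
/-- One more class. [cite: ConacheEtAl2015, §4.3] -/
theorem sweepRegionUpTo_succ {D : Finset ι} {col : ι → Fin χ} {ν : St} {n : ℕ} (hn : n < χ) :
    S.sweepRegionUpTo D col ν (n + 1) =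
      S.sweepList (classListIn D col ⟨n, hn⟩) (S.sweepRegionUpTo D col ν n) := by
  simp [sweepRegionUpTo, hn]

omit [Fintype A] in
/-- Lemma 3.4 (a) along the regional sweep (print: `ν_s^x ∈ 𝒞(μ^x, μ)` «by construction»).
[cite: ConacheEtAl2015, Lemma 3.4 (a), Lemma 3.8] -/
theorem sweepRegion_induction (P : St → Prop) (hP : ∀ ℓ ν, P ν → P (S.R ℓ ν)) (D : Finset ι)
    (col : ι → Fin χ) {ν : St} (hν : P ν) : P (S.sweepRegion D col ν) := by
  suffices h : ∀ n, P (S.sweepRegionUpTo D col ν n) from h χ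
  intro n
  induction n with
  | zero => exact hν
  | succ n ih =>
    by_cases hn : n < χ
    · rw [sweepRegionUpTo_succ hn]; exact S.sweepList_induction P hP _ _ ih
    · simp only [sweepRegionUpTo, hn, dite_false]; exact ih

/-- The invariant of §4.3: after the classes `V₀ ∩ D, …, V_{n−1} ∩ D`, the table on `D'` holds at
level `n` for `U = {ℓ ∈ D : col ℓ < n}`. [cite: ConacheEtAl2015, §4.2 (41)–(42), §4.3] -/
theorem tableOn_sweepRegionUpTo {Λ : Set ι} (h : S.IsDPStepOn Λ) {Δ : ℕ} {κbar cbar α : ℝ≥0}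
    (hA : S.Admissible Δ χ κbar cbar α) {col : ι → Fin χ}
    (hcol : ∀ ℓ, ∀ ℓ' ∈ S.nbr ℓ, col ℓ' ≠ col ℓ) {D : Finset ι} (hDΛ : ∀ ℓ ∈ D, ℓ ∈ Λ) {D' : Set ι}
    (hDD : ∀ ℓ ∈ D, ℓ ∈ D') (hnbrD : ∀ ℓ ∈ D, ∀ x ∈ S.nbr ℓ, x ∈ D') {γ₀ Λ₀ : ℝ≥0∞} {ν : St}
    (hγ : ∀ ℓ ∈ D', S.γf ν ℓ ≤ γ₀) (hΛ : ∀ a, ∀ ℓ ∈ D', ∀ ℓ' ∈ D', S.Λ ν a ℓ ℓ' ≤ Λ₀) :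
    ∀ n, n ≤ χ → S.TableOn Δ κbar cbar α γ₀ Λ₀ D' {ℓ | ℓ ∈ D ∧ (col ℓ : ℕ) < n} n
      (S.sweepRegionUpTo D col ν n) := by
  intro n
  induction n with
  | zero =>
    intro _
    have hU : {ℓ : ι | ℓ ∈ D ∧ ((col ℓ : Fin χ) : ℕ) < 0} = ∅ := by ext; simp
    rw [hU]
    exact tableOn_empty hγ hΛ
  | succ n ih =>
    intro hn
    have hn' : n < χ := by omega
    have hT := ih hn'.le
    rw [sweepRegionUpTo_succ hn']
    have hLnbr : ∀ ℓ ∈ classListIn D col ⟨n, hn'⟩, ∀ x ∈ S.nbr ℓ, x ∈ D' := fun ℓ hℓ =>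
      hnbrD ℓ (mem_classListIn.1 hℓ).1
    have hB := h.classBounds (classListIn D col ⟨n, hn'⟩) (nodup_classListIn D col _)
      (classListIn_independent hcol _) (fun x hx => hDΛ x (mem_classListIn.1 hx).1)
      (S.sweepRegionUpTo D col ν n)
    have hU : {ℓ : ι | ℓ ∈ D ∧ ((col ℓ : Fin χ) : ℕ) < n + 1} =
        {ℓ : ι | ℓ ∈ D ∧ ((col ℓ : Fin χ) : ℕ) < n} ∪ {x | x ∈ classListIn D col ⟨n, hn'⟩} := by
      ext ℓ
      simp only [Set.mem_setOf_eq, Set.mem_union, mem_classListIn, Fin.ext_iff]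
      constructor
      · rintro ⟨hD, hlt⟩
        rcases Nat.lt_succ_iff_lt_or_eq.1 hlt with h | h
        · exact Or.inl ⟨hD, h⟩
        · exact Or.inr ⟨hD, h⟩
      · rintro (⟨hD, h⟩ | ⟨hD, h⟩)
        · exact ⟨hD, by omega⟩
        · exact ⟨hD, by omega⟩
    rw [hU]
    rcases Nat.eq_zero_or_pos n with hn0 | hn0
    · subst hn0
      have hU0 : {ℓ : ι | ℓ ∈ D ∧ ((col ℓ : Fin χ) : ℕ) < 0} = ∅ := by ext; simp
      rw [hU0, Set.empty_union]
      have hT0 : S.TableOn Δ κbar cbar α γ₀ Λ₀ D' ∅ 0 (S.sweepRegionUpTo D col ν 0) :=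
        tableOn_empty hγ hΛ
      exact hA.tableOn_base (by omega) (fun ℓ hℓ => hT0.γ_W ℓ hℓ (by simp))
        (fun a ℓ hℓ ℓ' hℓ' => hT0.Λ_WW a ℓ ℓ' hℓ (by simp) hℓ' (by simp)) hLnbr hB
    · exact hA.tableOn_step hn0 (by omega) (fun ℓ hℓ => hDD ℓ hℓ.1) hT hLnbr hB

/-- **Lemma 3.8, one step (dc3), abstract form.** Let the one-step estimates hold at the sites of
`Λ` (`IsDPStepOn Λ`), `D ⊆ Λ` a finite region with
`D ∪ ∂D ⊆ D'` (every out-neighbourhood of a site of `D` lies in `D'`), `col` a proper `χ`-colouring,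
and `ν` a state with `γ_{D'}(ν) ≤ γ₀`, `λ_{D'}(ν) ≤ Λ₀`. Then the regional sweep `ν' = sweepRegion D ν`
satisfies, for `ℓ, ℓ' ∈ D`: `ν'(I_ℓ) ≤ [κ̄ + AK⁻¹] γ₀ + 2AK⁻¹ Λ₀` and
`ν'(I_ℓ H^i_{ℓ'}) ≤ Δ^χ γ₀ + c̄Δ^{χ+1} Λ₀` — i.e. `(γ_D(ν'), λ_D(ν'))ᵀ ≤ M (γ_{D'}(ν), λ_{D'}(ν))ᵀ`
with the second row that §4 yields (print (dc3) with `M(K)`'s printed second row `(Δ^{χ−1}, c̄Δ^χ)`;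
reading note E-DP-1). [cite: ConacheEtAl2015, Lemma 3.8 (dc3), §4.3] -/
theorem lemma_3_8_stepOn {Λ : Set ι} (h : S.IsDPStepOn Λ) {Δ : ℕ} {κbar cbar α : ℝ≥0}
    (hA : S.Admissible Δ χ κbar cbar α) {col : ι → Fin χ}
    (hcol : ∀ ℓ, ∀ ℓ' ∈ S.nbr ℓ, col ℓ' ≠ col ℓ) {D : Finset ι} (hDΛ : ∀ ℓ ∈ D, ℓ ∈ Λ) {D' : Set ι}
    (hDD : ∀ ℓ ∈ D, ℓ ∈ D') (hnbrD : ∀ ℓ ∈ D, ∀ x ∈ S.nbr ℓ, x ∈ D') {γ₀ Λ₀ : ℝ≥0∞} {ν : St}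
    (hγ : ∀ ℓ ∈ D', S.γf ν ℓ ≤ γ₀) (hΛ : ∀ a, ∀ ℓ ∈ D', ∀ ℓ' ∈ D', S.Λ ν a ℓ ℓ' ≤ Λ₀) :
    (∀ ℓ ∈ D, S.γf (S.sweepRegion D col ν) ℓ ≤ ((κbar : ℝ≥0∞) + α) * γ₀ + 2 * (α : ℝ≥0∞) * Λ₀) ∧
      ∀ a, ∀ ℓ ∈ D, ∀ ℓ' ∈ D, S.Λ (S.sweepRegion D col ν) a ℓ ℓ' ≤
        (Δ : ℝ≥0∞) ^ χ * γ₀ + (cbar : ℝ≥0∞) * (Δ : ℝ≥0∞) ^ (χ + 1) * Λ₀ := by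
  have hT := S.tableOn_sweepRegionUpTo h hA hcol hDΛ hDD hnbrD hγ hΛ χ le_rfl
  have hU : ∀ ℓ ∈ D, ℓ ∈ {ℓ : ι | ℓ ∈ D ∧ ((col ℓ : Fin χ) : ℕ) < χ} :=
    fun ℓ hℓ => ⟨hℓ, (col ℓ).isLt⟩
  exact ⟨fun ℓ hℓ => hT.γ_U ℓ (hU ℓ hℓ), fun a ℓ hℓ ℓ' hℓ' => hT.Λ_UU a ℓ ℓ' (hU ℓ hℓ) (hU ℓ' hℓ')⟩

/-- **Lemma 3.8, one step (dc3)**, for a system satisfying the one-step estimates everywhere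
(`IsDPStep`): as `lemma_3_8_stepOn` with `Λ = univ`. [cite: ConacheEtAl2015, Lemma 3.8 (dc3), §4.3] -/
theorem lemma_3_8_step (h : S.IsDPStep) {Δ : ℕ} {κbar cbar α : ℝ≥0}
    (hA : S.Admissible Δ χ κbar cbar α) {col : ι → Fin χ}
    (hcol : ∀ ℓ, ∀ ℓ' ∈ S.nbr ℓ, col ℓ' ≠ col ℓ) {D : Finset ι} {D' : Set ι}
    (hDD : ∀ ℓ ∈ D, ℓ ∈ D') (hnbrD : ∀ ℓ ∈ D, ∀ x ∈ S.nbr ℓ, x ∈ D') {γ₀ Λ₀ : ℝ≥0∞} {ν : St}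
    (hγ : ∀ ℓ ∈ D', S.γf ν ℓ ≤ γ₀) (hΛ : ∀ a, ∀ ℓ ∈ D', ∀ ℓ' ∈ D', S.Λ ν a ℓ ℓ' ≤ Λ₀) :
    (∀ ℓ ∈ D, S.γf (S.sweepRegion D col ν) ℓ ≤ ((κbar : ℝ≥0∞) + α) * γ₀ + 2 * (α : ℝ≥0∞) * Λ₀) ∧
      ∀ a, ∀ ℓ ∈ D, ∀ ℓ' ∈ D, S.Λ (S.sweepRegion D col ν) a ℓ ℓ' ≤
        (Δ : ℝ≥0∞) ^ χ * γ₀ + (cbar : ℝ≥0∞) * (Δ : ℝ≥0∞) ^ (χ + 1) * Λ₀ :=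
  S.lemma_3_8_stepOn (h.isDPStepOn Set.univ) hA hcol (fun _ _ => Set.mem_univ _) hDD hnbrD hγ hΛ

end region

/-! ### The decay recursion along a nested chain of regions: (dc3) iterated, (dc11)–(dc12) -/

section chain

variable {χ : ℕ}

/-- `γ_E(ν) = sup_{ℓ∈E} ν(I_ℓ)` (print (dc2)). [cite: ConacheEtAl2015, §3.4 (dc2)] -/
def γOn (S : DPSystem ι St A) (E : Finset ι) (ν : St) : ℝ≥0∞ := ⨆ ℓ ∈ E, S.γf ν ℓ

/-- `λ_E(ν) = max_i sup_{ℓ,ℓ'∈E} ν(I_ℓ H^i_{ℓ'})` (print (dc2)). [cite: ConacheEtAl2015, §3.4 (dc2)] -/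
def ΛOn (S : DPSystem ι St A) (E : Finset ι) (ν : St) : ℝ≥0∞ :=
  ⨆ a : A, ⨆ ℓ ∈ E, ⨆ ℓ' ∈ E, S.Λ ν a ℓ ℓ'

omit [Fintype A] in
/-- `ν(I_ℓ) ≤ γ_E(ν)` for `ℓ ∈ E`. [cite: ConacheEtAl2015, §3.4 (dc2)] -/
theorem le_γOn {E : Finset ι} {ν : St} {ℓ : ι} (hℓ : ℓ ∈ E) : S.γf ν ℓ ≤ S.γOn E ν :=
  le_iSup₂ (f := fun ℓ (_ : ℓ ∈ E) => S.γf ν ℓ) ℓ hℓ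

omit [Fintype A] in
/-- `ν(I_ℓ H^i_{ℓ'}) ≤ λ_E(ν)` for `ℓ, ℓ' ∈ E`. [cite: ConacheEtAl2015, §3.4 (dc2)] -/
theorem le_ΛOn {E : Finset ι} {ν : St} (a : A) {ℓ ℓ' : ι} (hℓ : ℓ ∈ E) (hℓ' : ℓ' ∈ E) :
    S.Λ ν a ℓ ℓ' ≤ S.ΛOn E ν := by
  refine le_trans ?_ (le_iSup (fun a : A => ⨆ ℓ ∈ E, ⨆ ℓ' ∈ E, S.Λ ν a ℓ ℓ') a)
  refine le_trans ?_ (le_iSup₂ (f := fun ℓ (_ : ℓ ∈ E) => ⨆ ℓ' ∈ E, S.Λ ν a ℓ ℓ') ℓ hℓ)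
  exact le_iSup₂ (f := fun ℓ' (_ : ℓ' ∈ E) => S.Λ ν a ℓ ℓ') ℓ' hℓ'

variable (S) in
/-- The chain of regional sweeps `ν₀, ν₁ = sweepRegion E₁ ν₀, ν₂ = sweepRegion E₂ ν₁, …` along a
sequence of regions `E` (print: `E_s = D_{N−1−s}`, `ν_s^x`). [cite: ConacheEtAl2015, Lemma 3.8] -/
def regionSeq (E : ℕ → Finset ι) (col : ι → Fin χ) (ν₀ : St) : ℕ → St
  | 0 => ν₀
  | s + 1 => S.sweepRegion (E (s + 1)) col (regionSeq E col ν₀ s)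

omit [Fintype A] in
/-- Lemma 3.4 (a) along the chain (every `ν_s` is a coupling of the same marginals «by
construction»). [cite: ConacheEtAl2015, Lemma 3.4 (a), Lemma 3.8] -/
theorem regionSeq_induction (P : St → Prop) (hP : ∀ ℓ ν, P ν → P (S.R ℓ ν)) (E : ℕ → Finset ι)
    (col : ι → Fin χ) {ν₀ : St} (hν : P ν₀) : ∀ n, P (S.regionSeq E col ν₀ n) := by
  intro n
  induction n with
  | zero => exact hν
  | succ n ih => exact S.sweepRegion_induction P hP (E (n + 1)) col ih

/-- **(dc3) along the chain.** If `E (s+1) ∪ ∂E (s+1) ⊆ E s` for all `s` (print: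
`D_k = D_{k−1} ∪ ∂D_{k−1}`), then for every `s`:
`γ_{E(s+1)}(ν_{s+1}) ≤ [κ̄ + α] γ_{E s}(ν_s) + 2α λ_{E s}(ν_s)` and
`λ_{E(s+1)}(ν_{s+1}) ≤ Δ^χ γ_{E s}(ν_s) + c̄Δ^{χ+1} λ_{E s}(ν_s)`.
[cite: ConacheEtAl2015, Lemma 3.8 (dc3)] -/
theorem regionSeq_recursionOn {Λ : Set ι} (h : S.IsDPStepOn Λ) {Δ : ℕ} {κbar cbar α : ℝ≥0}
    (hA : S.Admissible Δ χ κbar cbar α) {col : ι → Fin χ}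
    (hcol : ∀ ℓ, ∀ ℓ' ∈ S.nbr ℓ, col ℓ' ≠ col ℓ) {E : ℕ → Finset ι}
    (hEΛ : ∀ s, ∀ ℓ ∈ E (s + 1), ℓ ∈ Λ) (hE : ∀ s, ∀ ℓ ∈ E (s + 1), ℓ ∈ E s)
    (hEnbr : ∀ s, ∀ ℓ ∈ E (s + 1), ∀ x ∈ S.nbr ℓ, x ∈ E s) (ν₀ : St) (s : ℕ) :
    S.γOn (E (s + 1)) (S.regionSeq E col ν₀ (s + 1)) ≤
        ((κbar : ℝ≥0∞) + α) * S.γOn (E s) (S.regionSeq E col ν₀ s) +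
          2 * (α : ℝ≥0∞) * S.ΛOn (E s) (S.regionSeq E col ν₀ s) ∧
      S.ΛOn (E (s + 1)) (S.regionSeq E col ν₀ (s + 1)) ≤
        (Δ : ℝ≥0∞) ^ χ * S.γOn (E s) (S.regionSeq E col ν₀ s) +
          (cbar : ℝ≥0∞) * (Δ : ℝ≥0∞) ^ (χ + 1) * S.ΛOn (E s) (S.regionSeq E col ν₀ s) := by
  set ν := S.regionSeq E col ν₀ s
  have hstep := S.lemma_3_8_stepOn h hA hcol (D := E (s + 1)) (hEΛ s) (D' := (↑(E s) : Set ι))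
    (fun ℓ hℓ => Finset.mem_coe.2 (hE s ℓ hℓ))
    (fun ℓ hℓ x hx => Finset.mem_coe.2 (hEnbr s ℓ hℓ x hx)) (ν := ν)
    (γ₀ := S.γOn (E s) ν) (Λ₀ := S.ΛOn (E s) ν)
    (fun ℓ hℓ => S.le_γOn (Finset.mem_coe.1 hℓ))
    (fun a ℓ hℓ ℓ' hℓ' => S.le_ΛOn a (Finset.mem_coe.1 hℓ) (Finset.mem_coe.1 hℓ'))
  change S.γOn (E (s + 1)) (S.sweepRegion (E (s + 1)) col ν) ≤ _ ∧
    S.ΛOn (E (s + 1)) (S.sweepRegion (E (s + 1)) col ν) ≤ _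
  refine ⟨iSup₂_le fun ℓ hℓ => hstep.1 ℓ hℓ, iSup_le fun a => iSup₂_le fun ℓ hℓ =>
    iSup₂_le fun ℓ' hℓ' => hstep.2 a ℓ hℓ ℓ' hℓ'⟩

/-- **(dc3) along the chain** for a system satisfying the one-step estimates everywhere: as
`regionSeq_recursionOn` with `Λ = univ`. [cite: ConacheEtAl2015, Lemma 3.8 (dc3)] -/
theorem regionSeq_recursion (h : S.IsDPStep) {Δ : ℕ} {κbar cbar α : ℝ≥0}
    (hA : S.Admissible Δ χ κbar cbar α) {col : ι → Fin χ}
    (hcol : ∀ ℓ, ∀ ℓ' ∈ S.nbr ℓ, col ℓ' ≠ col ℓ) {E : ℕ → Finset ι}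
    (hE : ∀ s, ∀ ℓ ∈ E (s + 1), ℓ ∈ E s)
    (hEnbr : ∀ s, ∀ ℓ ∈ E (s + 1), ∀ x ∈ S.nbr ℓ, x ∈ E s) (ν₀ : St) (s : ℕ) :
    S.γOn (E (s + 1)) (S.regionSeq E col ν₀ (s + 1)) ≤
        ((κbar : ℝ≥0∞) + α) * S.γOn (E s) (S.regionSeq E col ν₀ s) +
          2 * (α : ℝ≥0∞) * S.ΛOn (E s) (S.regionSeq E col ν₀ s) ∧
      S.ΛOn (E (s + 1)) (S.regionSeq E col ν₀ (s + 1)) ≤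
        (Δ : ℝ≥0∞) ^ χ * S.γOn (E s) (S.regionSeq E col ν₀ s) +
          (cbar : ℝ≥0∞) * (Δ : ℝ≥0∞) ^ (χ + 1) * S.ΛOn (E s) (S.regionSeq E col ν₀ s) :=
  S.regionSeq_recursionOn (h.isDPStepOn Set.univ) hA hcol (fun _ _ _ => Set.mem_univ _) hE hEnbr ν₀ s

/-- **(dc11)–(dc12): geometric decay along the chain of regions.** For any weight `0 < ξ < ∞` and
rate `r` with `(κ̄ + α) + ξ·2α ≤ r` and `Δ^χ + ξ·c̄Δ^{χ+1} ≤ ξ r` (the two row sums of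
`T M T⁻¹`, `T = diag(ξ, 1)`), along a nested chain `E (s+1) ∪ ∂E (s+1) ⊆ E s`:
`γ_{E n}(ν_n) ≤ rⁿ · max{γ_{E 0}(ν₀), ξ⁻¹ λ_{E 0}(ν₀)}` — with `E s = D_{N−1−s}`, `n = N − 1` this is
(dc12) `γ_{D₀}(ν_{N−1}) ≤ r^{N−1} max{γ_{D_{N−1}}(ν₀), ξ⁻¹λ_{D_{N−1}}(ν₀)}`.
[cite: ConacheEtAl2015, §3.4 (dc11)–(dc12)] -/
theorem regionSeq_decayOn {Λ : Set ι} (h : S.IsDPStepOn Λ) {Δ : ℕ} {κbar cbar α : ℝ≥0}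
    (hA : S.Admissible Δ χ κbar cbar α) {col : ι → Fin χ}
    (hcol : ∀ ℓ, ∀ ℓ' ∈ S.nbr ℓ, col ℓ' ≠ col ℓ) {E : ℕ → Finset ι}
    (hEΛ : ∀ s, ∀ ℓ ∈ E (s + 1), ℓ ∈ Λ) (hE : ∀ s, ∀ ℓ ∈ E (s + 1), ℓ ∈ E s)
    (hEnbr : ∀ s, ∀ ℓ ∈ E (s + 1), ∀ x ∈ S.nbr ℓ, x ∈ E s) (ν₀ : St) {r ξ : ℝ≥0∞}
    (hξ0 : ξ ≠ 0) (hξt : ξ ≠ ∞) (hrow₁ : ((κbar : ℝ≥0∞) + α) + ξ * (2 * (α : ℝ≥0∞)) ≤ r)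
    (hrow₂ : (Δ : ℝ≥0∞) ^ χ + ξ * ((cbar : ℝ≥0∞) * (Δ : ℝ≥0∞) ^ (χ + 1)) ≤ ξ * r) (n : ℕ) :
    S.γOn (E n) (S.regionSeq E col ν₀ n) ≤
      r ^ n * max (S.γOn (E 0) ν₀) (ξ⁻¹ * S.ΛOn (E 0) ν₀) := by
  have key := DobrushinPecherskyContraction.fst_iterate_le hξ0 hξt hrow₁ hrow₂
    (fun s => S.γOn (E s) (S.regionSeq E col ν₀ s)) (fun s => S.ΛOn (E s) (S.regionSeq E col ν₀ s))
    (fun s => by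
      simpa [mul_assoc] using (S.regionSeq_recursionOn h hA hcol hEΛ hE hEnbr ν₀ s).1)
    (fun s => by
      simpa [mul_assoc] using (S.regionSeq_recursionOn h hA hcol hEΛ hE hEnbr ν₀ s).2) n
  simpa [regionSeq] using key

/-- **(dc11)–(dc12)** for a system satisfying the one-step estimates everywhere: as
`regionSeq_decayOn` with `Λ = univ`. [cite: ConacheEtAl2015, §3.4 (dc11)–(dc12)] -/
theorem regionSeq_decay (h : S.IsDPStep) {Δ : ℕ} {κbar cbar α : ℝ≥0}
    (hA : S.Admissible Δ χ κbar cbar α) {col : ι → Fin χ}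
    (hcol : ∀ ℓ, ∀ ℓ' ∈ S.nbr ℓ, col ℓ' ≠ col ℓ) {E : ℕ → Finset ι}
    (hE : ∀ s, ∀ ℓ ∈ E (s + 1), ℓ ∈ E s)
    (hEnbr : ∀ s, ∀ ℓ ∈ E (s + 1), ∀ x ∈ S.nbr ℓ, x ∈ E s) (ν₀ : St) {r ξ : ℝ≥0∞}
    (hξ0 : ξ ≠ 0) (hξt : ξ ≠ ∞) (hrow₁ : ((κbar : ℝ≥0∞) + α) + ξ * (2 * (α : ℝ≥0∞)) ≤ r)
    (hrow₂ : (Δ : ℝ≥0∞) ^ χ + ξ * ((cbar : ℝ≥0∞) * (Δ : ℝ≥0∞) ^ (χ + 1)) ≤ ξ * r) (n : ℕ) :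
    S.γOn (E n) (S.regionSeq E col ν₀ n) ≤
      r ^ n * max (S.γOn (E 0) ν₀) (ξ⁻¹ * S.ΛOn (E 0) ν₀) :=
  S.regionSeq_decayOn (h.isDPStepOn Set.univ) hA hcol (fun _ _ _ => Set.mem_univ _) hE hEnbr ν₀
    hξ0 hξt hrow₁ hrow₂ n

/-- **Print's indexing of the chain.** For regions `D₀, D₁, D₂, …` (print: `D₀ = {ℓ₁}`,
`D_k = D_{k−1} ∪ ∂D_{k−1}`) and `N ≥ 1`, the chain that is swept is `E_s = D_{N−1−s}` for `s < N`
(and `∅` afterwards, where nothing happens). [cite: ConacheEtAl2015, §3.4 before Lemma 3.8] -/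
def descChain (D : ℕ → Finset ι) (N : ℕ) (s : ℕ) : Finset ι := if s < N then D (N - 1 - s) else ∅

omit [Fintype A] in
/-- `E₀ = D_{N−1}`. [cite: ConacheEtAl2015, §3.4 before Lemma 3.8] -/
theorem descChain_zero {D : ℕ → Finset ι} {N : ℕ} (hN : 1 ≤ N) : descChain D N 0 = D (N - 1) := by
  simp [descChain, show 0 < N by omega]

omit [Fintype A] in
/-- `E_{N−1} = D₀`. [cite: ConacheEtAl2015, §3.4 before Lemma 3.8] -/
theorem descChain_pred {D : ℕ → Finset ι} {N : ℕ} (hN : 1 ≤ N) :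
    descChain D N (N - 1) = D 0 := by
  simp [descChain, show N - 1 < N by omega]

omit [Fintype A] in
/-- `E_{s+1} ⊆ E_s` when `D_k ⊆ D_{k+1}`. [cite: ConacheEtAl2015, §3.4 before Lemma 3.8] -/
theorem descChain_nested {D : ℕ → Finset ι} (hD : ∀ k, ∀ ℓ ∈ D k, ℓ ∈ D (k + 1)) (N : ℕ) :
    ∀ s, ∀ ℓ ∈ descChain D N (s + 1), ℓ ∈ descChain D N s := by
  intro s ℓ hℓ
  unfold descChain at hℓ ⊢
  by_cases hs : s + 1 < N
  · rw [if_pos hs] at hℓ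
    rw [if_pos (by omega)]
    have := hD (N - 1 - (s + 1)) ℓ hℓ
    rwa [show N - 1 - (s + 1) + 1 = N - 1 - s by omega] at this
  · simp [hs] at hℓ

omit [Fintype A] in
/-- `∂E_{s+1} ⊆ E_s` (out-neighbourhoods) when `D_k ∪ ∂D_k ⊆ D_{k+1}`.
[cite: ConacheEtAl2015, §3.4 before Lemma 3.8] -/
theorem descChain_nbr {D : ℕ → Finset ι} (hDnbr : ∀ k, ∀ ℓ ∈ D k, ∀ x ∈ S.nbr ℓ, x ∈ D (k + 1))
    (N : ℕ) : ∀ s, ∀ ℓ ∈ descChain D N (s + 1), ∀ x ∈ S.nbr ℓ, x ∈ descChain D N s := by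
  intro s ℓ hℓ x hx
  unfold descChain at hℓ ⊢
  by_cases hs : s + 1 < N
  · rw [if_pos hs] at hℓ
    rw [if_pos (by omega)]
    have := hDnbr (N - 1 - (s + 1)) ℓ hℓ x hx
    rwa [show N - 1 - (s + 1) + 1 = N - 1 - s by omega] at this
  · simp [hs] at hℓ

omit [Fintype A] in
/-- The regions swept down the chain, `E_{s+1} = D_{N−2−s}` (`s + 1 < N`), all lie in `Λ` as soon as
`D₀, …, D_{N−2} ⊆ Λ` (print: `Λ = D_{N−1}`). [cite: ConacheEtAl2015, §3.4 before Lemma 3.8] -/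
theorem descChain_succ_subset {D : ℕ → Finset ι} {N : ℕ} {Λ : Set ι}
    (hDΛ : ∀ k, k + 1 < N → ∀ ℓ ∈ D k, ℓ ∈ Λ) :
    ∀ s, ∀ ℓ ∈ descChain D N (s + 1), ℓ ∈ Λ := by
  intro s ℓ hℓ
  unfold descChain at hℓ
  by_cases hs : s + 1 < N
  · rw [if_pos hs] at hℓ
    exact hDΛ (N - 1 - (s + 1)) (by omega) ℓ hℓ
  · simp [hs] at hℓ

/-- **(dc12) as printed.** For one-step estimates on `Λ ⊇ D₀, …, D_{N−2}` (print: `Λ = D_{N−1}`),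
regions `D₀ ⊆ D₁ ⊆ ⋯` with `D_k ∪ ∂D_k ⊆ D_{k+1}` (out-neighbourhoods),
`N ≥ 1`, the states `ν_s` obtained by sweeping `D_{N−1−s}` at step `s = 1, …, N − 1`, and any weight ∕
rate `(ξ, r)` meeting the two row sums of `T M T⁻¹`:
`γ_{D₀}(ν_{N−1}) ≤ r^{N−1} · max{γ_{D_{N−1}}(ν₀), ξ⁻¹ λ_{D_{N−1}}(ν₀)}`.
[cite: ConacheEtAl2015, §3.4 (dc12)] -/
theorem dc12_printedOn {Λ : Set ι} (h : S.IsDPStepOn Λ) {Δ : ℕ} {κbar cbar α : ℝ≥0}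
    (hA : S.Admissible Δ χ κbar cbar α) {col : ι → Fin χ}
    (hcol : ∀ ℓ, ∀ ℓ' ∈ S.nbr ℓ, col ℓ' ≠ col ℓ) {D : ℕ → Finset ι} {N : ℕ} (hN : 1 ≤ N)
    (hDΛ : ∀ k, k + 1 < N → ∀ ℓ ∈ D k, ℓ ∈ Λ)
    (hD : ∀ k, ∀ ℓ ∈ D k, ℓ ∈ D (k + 1)) (hDnbr : ∀ k, ∀ ℓ ∈ D k, ∀ x ∈ S.nbr ℓ, x ∈ D (k + 1))
    (ν₀ : St) {r ξ : ℝ≥0∞} (hξ0 : ξ ≠ 0) (hξt : ξ ≠ ∞)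
    (hrow₁ : ((κbar : ℝ≥0∞) + α) + ξ * (2 * (α : ℝ≥0∞)) ≤ r)
    (hrow₂ : (Δ : ℝ≥0∞) ^ χ + ξ * ((cbar : ℝ≥0∞) * (Δ : ℝ≥0∞) ^ (χ + 1)) ≤ ξ * r) :
    S.γOn (D 0) (S.regionSeq (descChain D N) col ν₀ (N - 1)) ≤
      r ^ (N - 1) * max (S.γOn (D (N - 1)) ν₀) (ξ⁻¹ * S.ΛOn (D (N - 1)) ν₀) := by
  have key := S.regionSeq_decayOn h hA hcol (descChain_succ_subset hDΛ) (descChain_nested hD N)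
    (S.descChain_nbr hDnbr N) ν₀ hξ0 hξt hrow₁ hrow₂ (N - 1)
  rwa [descChain_pred hN, descChain_zero hN] at key

/-- **(dc12) as printed** for a system satisfying the one-step estimates everywhere: as
`dc12_printedOn` with `Λ = univ`. [cite: ConacheEtAl2015, §3.4 (dc12)] -/
theorem dc12_printed (h : S.IsDPStep) {Δ : ℕ} {κbar cbar α : ℝ≥0}
    (hA : S.Admissible Δ χ κbar cbar α) {col : ι → Fin χ}
    (hcol : ∀ ℓ, ∀ ℓ' ∈ S.nbr ℓ, col ℓ' ≠ col ℓ) {D : ℕ → Finset ι}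
    (hD : ∀ k, ∀ ℓ ∈ D k, ℓ ∈ D (k + 1)) (hDnbr : ∀ k, ∀ ℓ ∈ D k, ∀ x ∈ S.nbr ℓ, x ∈ D (k + 1))
    {N : ℕ} (hN : 1 ≤ N) (ν₀ : St) {r ξ : ℝ≥0∞} (hξ0 : ξ ≠ 0) (hξt : ξ ≠ ∞)
    (hrow₁ : ((κbar : ℝ≥0∞) + α) + ξ * (2 * (α : ℝ≥0∞)) ≤ r)
    (hrow₂ : (Δ : ℝ≥0∞) ^ χ + ξ * ((cbar : ℝ≥0∞) * (Δ : ℝ≥0∞) ^ (χ + 1)) ≤ ξ * r) :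
    S.γOn (D 0) (S.regionSeq (descChain D N) col ν₀ (N - 1)) ≤
      r ^ (N - 1) * max (S.γOn (D (N - 1)) ν₀) (ξ⁻¹ * S.ΛOn (D (N - 1)) ν₀) :=
  S.dc12_printedOn (h.isDPStepOn Set.univ) hA hcol hN (fun _ _ _ _ => Set.mem_univ _) hD hDnbr ν₀
    hξ0 hξt hrow₁ hrow₂

/-- **Theorem 2.7, quantitative core: the rate `r_K < 1`.** Below the threshold — `κ̄ + α < 1`,
`c̄Δ^{χ+1} < 1`, `2α·Δ^χ < (1 − κ̄ − α)(1 − c̄Δ^{χ+1})`, `α = AK⁻¹ > 0` — there are `r < 1` (the Perron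
root of `[[κ̄ + α, 2α], [Δ^χ, c̄Δ^{χ+1}]]`, the shape of (srM)) and `ξ > 0` such that along EVERY nested
chain of regions and from every initial state, `γ_{E n}(ν_n) ≤ rⁿ · max{γ_{E 0}(ν₀), ξ⁻¹ λ_{E 0}(ν₀)}`
(print (dc12) with `r = r_K`, whence (dc13) `α_K = −log r_K`; the printed threshold `K > K_*` reads the
same with the printed second row `(Δ^{χ−1}, c̄Δ^χ)` — reading note E-DP-1).
[cite: ConacheEtAl2015, Theorem 2.7 via (dc12)–(dc13), (srM)] -/
theorem exists_regional_rate_lt_oneOn {Λ : Set ι} (h : S.IsDPStepOn Λ) {Δ : ℕ}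
    {κbar cbar α : ℝ≥0} (hA : S.Admissible Δ χ κbar cbar α) {col : ι → Fin χ}
    (hcol : ∀ ℓ, ∀ ℓ' ∈ S.nbr ℓ, col ℓ' ≠ col ℓ) (hα : 0 < α) (h1 : κbar + α < 1)
    (h2 : cbar * (Δ : ℝ≥0) ^ (χ + 1) < 1)
    (h3 : 2 * α * (Δ : ℝ≥0) ^ χ < (1 - (κbar + α)) * (1 - cbar * (Δ : ℝ≥0) ^ (χ + 1))) :
    ∃ r ξ : ℝ≥0, (r : ℝ) = DobrushinPecherskyContraction.perronRoot (κbar + α) (2 * α)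
        ((Δ : ℝ) ^ χ) (cbar * (Δ : ℝ) ^ (χ + 1)) ∧ r < 1 ∧ 0 < ξ ∧
      ∀ (E : ℕ → Finset ι), (∀ s, ∀ ℓ ∈ E (s + 1), ℓ ∈ Λ) → (∀ s, ∀ ℓ ∈ E (s + 1), ℓ ∈ E s) →
        (∀ s, ∀ ℓ ∈ E (s + 1), ∀ x ∈ S.nbr ℓ, x ∈ E s) → ∀ (ν₀ : St) (n : ℕ),
        S.γOn (E n) (S.regionSeq E col ν₀ n) ≤
          (r : ℝ≥0∞) ^ n * max (S.γOn (E 0) ν₀) ((ξ : ℝ≥0∞)⁻¹ * S.ΛOn (E 0) ν₀) := by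
  have hb : (0 : ℝ≥0) < 2 * α := by positivity
  have hΔ : (0 : ℝ≥0) < (Δ : ℝ≥0) := by
    have := hA.two_le; exact_mod_cast (show 0 < Δ by omega)
  have hc : (0 : ℝ≥0) < (Δ : ℝ≥0) ^ χ := pow_pos hΔ χ
  obtain ⟨r, ξ, hr, hξ0, hξt, hrow₁, hrow₂, hiff⟩ :=
    DobrushinPecherskyContraction.exists_weight_ennreal (κbar + α) (2 * α) ((Δ : ℝ≥0) ^ χ)
      (cbar * (Δ : ℝ≥0) ^ (χ + 1)) hb hc
  have hr1 : r < 1 := by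
    have := hiff.2 ⟨h1, h2, h3⟩
    exact_mod_cast this
  have hξpos : 0 < ξ := pos_iff_ne_zero.2 fun h0 => hξ0 (by simp [h0])
  refine ⟨r, ξ, by simpa using hr, hr1, hξpos, fun E hEΛ hE hEnbr ν₀ n => ?_⟩
  refine S.regionSeq_decayOn h hA hcol hEΛ hE hEnbr ν₀ hξ0 hξt ?_ ?_ n
  · exact_mod_cast hrow₁
  · exact_mod_cast hrow₂

/-- **The rate and the weight depend on the constants only.** `r` (the Perron root) and `ξ` can
be chosen from `Δ, χ, κ̄, c̄, α` BEFORE the system: the bound of `exists_regional_rate_lt_oneOn` then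
holds for EVERY system with these admissible constants and the one-step estimates on the swept
regions (Theorem 2.7 applies it to the `x`-dependent systems built from `μ^x`, with one `(r_K, ξ)`;
print: «`C_K` and `α_K`, dependent on `K` only»). [cite: ConacheEtAl2015, Theorem 2.7, (srM), (dc11)] -/
theorem exists_uniform_regional_rate {Δ χ : ℕ} {κbar cbar α : ℝ≥0} (hΔ : 0 < Δ) (hα : 0 < α)
    (h1 : κbar + α < 1) (h2 : cbar * (Δ : ℝ≥0) ^ (χ + 1) < 1)
    (h3 : 2 * α * (Δ : ℝ≥0) ^ χ < (1 - (κbar + α)) * (1 - cbar * (Δ : ℝ≥0) ^ (χ + 1))) :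
    ∃ r ξ : ℝ≥0, (r : ℝ) = DobrushinPecherskyContraction.perronRoot (κbar + α) (2 * α)
        ((Δ : ℝ) ^ χ) (cbar * (Δ : ℝ) ^ (χ + 1)) ∧ r < 1 ∧ 0 < ξ ∧
      ∀ (S : DPSystem ι St A) {Λ : Set ι}, S.IsDPStepOn Λ → S.Admissible Δ χ κbar cbar α →
        ∀ {col : ι → Fin χ}, (∀ ℓ, ∀ ℓ' ∈ S.nbr ℓ, col ℓ' ≠ col ℓ) →
        ∀ (E : ℕ → Finset ι), (∀ s, ∀ ℓ ∈ E (s + 1), ℓ ∈ Λ) → (∀ s, ∀ ℓ ∈ E (s + 1), ℓ ∈ E s) →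
        (∀ s, ∀ ℓ ∈ E (s + 1), ∀ x ∈ S.nbr ℓ, x ∈ E s) → ∀ (ν₀ : St) (n : ℕ),
        S.γOn (E n) (S.regionSeq E col ν₀ n) ≤
          (r : ℝ≥0∞) ^ n * max (S.γOn (E 0) ν₀) ((ξ : ℝ≥0∞)⁻¹ * S.ΛOn (E 0) ν₀) := by
  have hb : (0 : ℝ≥0) < 2 * α := by positivity
  have hc : (0 : ℝ≥0) < (Δ : ℝ≥0) ^ χ := pow_pos (by exact_mod_cast hΔ) χ
  obtain ⟨r, ξ, hr, hξ0, hξt, hrow₁, hrow₂, hiff⟩ :=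
    DobrushinPecherskyContraction.exists_weight_ennreal (κbar + α) (2 * α) ((Δ : ℝ≥0) ^ χ)
      (cbar * (Δ : ℝ≥0) ^ (χ + 1)) hb hc
  have hr1 : r < 1 := by
    have := hiff.2 ⟨h1, h2, h3⟩
    exact_mod_cast this
  have hξpos : 0 < ξ := pos_iff_ne_zero.2 fun h0 => hξ0 (by simp [h0])
  refine ⟨r, ξ, by simpa using hr, hr1, hξpos, ?_⟩
  intro S Λ h hA col hcol E hEΛ hE hEnbr ν₀ n
  refine S.regionSeq_decayOn h hA hcol hEΛ hE hEnbr ν₀ hξ0 hξt ?_ ?_ n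
  · exact_mod_cast hrow₁
  · exact_mod_cast hrow₂

/-- **Theorem 2.7, quantitative core: the rate `r_K < 1`** for a system satisfying the one-step
estimates everywhere: as `exists_regional_rate_lt_oneOn` with `Λ = univ`.
[cite: ConacheEtAl2015, Theorem 2.7 via (dc12)–(dc13), (srM)] -/
theorem exists_regional_rate_lt_one (h : S.IsDPStep) {Δ : ℕ} {κbar cbar α : ℝ≥0}
    (hA : S.Admissible Δ χ κbar cbar α) {col : ι → Fin χ}
    (hcol : ∀ ℓ, ∀ ℓ' ∈ S.nbr ℓ, col ℓ' ≠ col ℓ) (hα : 0 < α) (h1 : κbar + α < 1)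
    (h2 : cbar * (Δ : ℝ≥0) ^ (χ + 1) < 1)
    (h3 : 2 * α * (Δ : ℝ≥0) ^ χ < (1 - (κbar + α)) * (1 - cbar * (Δ : ℝ≥0) ^ (χ + 1))) :
    ∃ r ξ : ℝ≥0, (r : ℝ) = DobrushinPecherskyContraction.perronRoot (κbar + α) (2 * α)
        ((Δ : ℝ) ^ χ) (cbar * (Δ : ℝ) ^ (χ + 1)) ∧ r < 1 ∧ 0 < ξ ∧
      ∀ (E : ℕ → Finset ι), (∀ s, ∀ ℓ ∈ E (s + 1), ℓ ∈ E s) →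
        (∀ s, ∀ ℓ ∈ E (s + 1), ∀ x ∈ S.nbr ℓ, x ∈ E s) → ∀ (ν₀ : St) (n : ℕ),
        S.γOn (E n) (S.regionSeq E col ν₀ n) ≤
          (r : ℝ≥0∞) ^ n * max (S.γOn (E 0) ν₀) ((ξ : ℝ≥0∞)⁻¹ * S.ΛOn (E 0) ν₀) := by
  obtain ⟨r, ξ, hr, hr1, hξ, hrate⟩ :=
    S.exists_regional_rate_lt_oneOn (h.isDPStepOn Set.univ) hA hcol hα h1 h2 h3
  exact ⟨r, ξ, hr, hr1, hξ, fun E hE hEnbr ν₀ n =>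
    hrate E (fun _ _ _ => Set.mem_univ _) hE hEnbr ν₀ n⟩

end chain

end DPSystem

end DobrushinPecherskySweep

end Literature.Probability.TransportMaps
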